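import Literature.Geometry.Lorentzian.IMCFMeanCurvatureEvolution
import Literature.Geometry.Lorentzian.MetricDetComparison
import Literature.Geometry.Lorentzian.EnergyCurrents
import HarnessLib

/-!
# The second variation of the area element of an immersed surface (pointwise)

Schoen–Yau 1979 (Comm. Math. Phys. 65, §2, Step 3, p. 53) use that a complete area-minimising
surface `S` in a Riemannian `3`-manifold `(X, h)` is *stable*: for every smooth `f` of compact
support on `S`, (2.13) `∫_S (Ric(ν,ν) + ‖A‖²) f² ≤ ∫_S ‖∇f‖²` — "by stability", i.e. by the
second variation formula for the area under the normal deformation `f ν` (Lawson 1980, Ch. I,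
Thm. 7.2; Simons 1968, §3.2; Huisken–Polden 1999, Thm. 3.2 for the evolution of `g` and `dμ`
under `∂ₜF = f ν`). This file proves the **pointwise** second variation of the area element, for
an arbitrary smooth one-parameter family `F : ℝ → S → X` of immersions of a surface (smooth on
`(a, b) × S`) whose variation field at ONE time `t₀` is normal, `∂ₜF(t₀, ·) = f ν` — the family is
not assumed to move by a normal speed at other times, so that flows of compactly supported ambient
vector fields (the deformations under which an area-minimising surface is minimal) are covered.

* `tvelocity`, `acceleration` — the variation field `∂ₜF(t, ·)` and the acceleration field
  `D_t ∂ₜF(t, ·)` of a family, as fields along `F t` (real definitions, any manifolds).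
* `SurfaceVariation.hasDerivAt_val_mfderiv` — **first derivative of the induced metric** at every
  `t ∈ (a, b)`: `∂_τ h(dF_τ v, dF_τ w) = h(P_v, dF w) + h(dF v, P_w)` with `P_v = D_v ∂ₜF`
  (metric compatibility along `τ ↦ F τ p` and the symmetry lemma `D_t dF(v) = D_v ∂ₜF`,
  O'Neill 1983, Prop. 4.44 (1)); `SurfaceVariation.hasDerivAt_gramDeriv_entry` — and its
  derivative, `h(D_t P_v, dF w) + h(P_v, P_w) + h(D_t P_w, dF v) + h(P_w, P_v)`.
* `SurfaceVariation.val_covariantDerivAlong_P_eq` — `D_t P_v = D_v a + R(∂ₜF, dF v) ∂ₜF`,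
  `a` the acceleration field (O'Neill 1983, Prop. 4.44 (2),
  `covariantDerivAlong_covariantDerivAlong_sub_eq_curvature`).
* At `t₀`, with `∂ₜF(t₀, ·) = f ν`: `P_v = (vf) ν + f D_v ν` (`covariantDerivAlong_tvelocity_eq`),
  `h(P_v, dF w) = f K(v, w)` (`val_P_mfderiv_eq`, so `∂ₜ gᵢⱼ = 2 f Kᵢⱼ`),
  `h(P_v, P_w) = (vf)(wf) + f² h(D_vν, D_wν)` (`val_P_P_eq`), and the frame formulas for `H`,
  `‖A‖²`, `‖∇f‖²`, `h(D_vν, D_vν)`, `Ric(ν,ν)` in an orthonormal basis adapted to `F_{t₀}`.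
* `SurfaceVariation.hasDerivAt_det_gram` — **the second variation of the area element**: for an
  `(F_{t₀}^*h)`-orthonormal basis `β` of `T_p S`, the Gram determinant
  `D(τ) = det h(dF_τ βᵢ, dF_τ βⱼ)` (the squared area element of `F_τ` relative to `F_{t₀}` at `p`)
  is differentiable on `(a, b)` with derivative `D₁`, `D(t₀) = 1`, `D₁(t₀) = 2 f H`, and
  `D₁'(t₀) = 2‖∇f‖² − 2f²‖A‖² + 4f²H² − 2f² Ric(ν,ν) + 2 ∑ᵢ h(D_{βᵢ} a, dF βᵢ)`; hence the
  area element `J = √D` has `J'(t₀) = f H` and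
  `J''(t₀) = ‖∇f‖² − f²‖A‖² + f²H² − f² Ric(ν,ν) + ∑ᵢ h(D_{βᵢ} a, dF βᵢ)`, whose integral at a
  minimal immersion (`H = 0`; the last term integrates to `∫ H h(a, ν) = 0`) is the classical
  `∫ ‖∇f‖² − (‖A‖² + Ric(ν,ν)) f²`.

Everything is proved; the only definitions are `tvelocity` and `acceleration`; no named facts.

## References

* R. Schoen, S.-T. Yau, *On the proof of the positive mass conjecture in general relativity*,
  Comm. Math. Phys. 65 (1979) 45–76, §2, (2.13). [SchoenYauPMT1979]
* H. B. Lawson, *Lectures on minimal submanifolds*, Vol. I, Publish or Perish 1980, Ch. I §7,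
  Thm. 7.2 (second variation formula).
* J. Simons, *Minimal varieties in riemannian manifolds*, Ann. of Math. 88 (1968) 62–105, §3.2.
* G. Huisken, A. Polden, *Geometric evolution equations for hypersurfaces*, LNM 1713 (1999),
  Thm. 3.2.
* B. O'Neill, *Semi-Riemannian geometry*, Academic Press 1983, Ch. 3, Prop. 3.18; Ch. 4,
  Lemma 4.19, Prop. 4.44.
-/

noncomputable section

open Bundle Set Manifold TopologicalSpace Filter Function
open scoped ContDiff Topology Manifold Matrix

namespace Literature.Geometry.Lorentzian

open PseudoRiemannianMetric

namespace SurfaceVariation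

variable {X : Type*} [TopologicalSpace X] [ChartedSpace E3 X] [IsManifold (𝓡 3) ∞ X]
  {h : ContMDiffRiemannianMetric (𝓡 3) ∞ E3 (TangentSpace (𝓡 3) : X → Type _)}
  [(ofRiemannian h).HasLeviCivita]
  {S : Type*} [TopologicalSpace S] [ChartedSpace (EuclideanSpace ℝ (Fin 2)) S]
  [IsManifold (𝓡 2) ∞ S]
  {F : ℝ → S → X} {a b : ℝ}

/-! ### Regularity of the family, of its slices and of the two-parameter maps through
chart-straight curves -/

omit [(ofRiemannian h).HasLeviCivita] [IsManifold (𝓡 3) ∞ X] [IsManifold (𝓡 2) ∞ S] in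
/-- The family `(t, y) ↦ F t y`, smooth on `(a, b) × S`, is smooth at every `(t, y)` with
`t ∈ (a, b)`. [folklore] -/
theorem contMDiffAt_uncurry
    (hF : ContMDiffOn (𝓘(ℝ, ℝ).prod (𝓡 2)) (𝓡 3) ∞ (fun q : ℝ × S ↦ F q.1 q.2) (Ioo a b ×ˢ univ))
    {t : ℝ} (ht : t ∈ Ioo a b) (y : S) :
    ContMDiffAt (𝓘(ℝ, ℝ).prod (𝓡 2)) (𝓡 3) ∞ (fun q : ℝ × S ↦ F q.1 q.2) (t, y) :=
  hF.contMDiffAt ((isOpen_Ioo.prod isOpen_univ).mem_nhds ⟨ht, mem_univ y⟩)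

omit [(ofRiemannian h).HasLeviCivita] [IsManifold (𝓡 3) ∞ X] [IsManifold (𝓡 2) ∞ S] in
/-- Each slice `F t`, `t ∈ (a, b)`, of a smooth family is smooth. [folklore] -/
theorem contMDiffAt_slice
    (hF : ContMDiffOn (𝓘(ℝ, ℝ).prod (𝓡 2)) (𝓡 3) ∞ (fun q : ℝ × S ↦ F q.1 q.2) (Ioo a b ×ˢ univ))
    {t : ℝ} (ht : t ∈ Ioo a b) (y : S) : ContMDiffAt (𝓡 2) (𝓡 3) ∞ (F t) y := by
  have h1 : ContMDiffAt (𝓡 2) (𝓘(ℝ, ℝ).prod (𝓡 2)) ∞ (fun y' : S ↦ ((t, y') : ℝ × S)) y :=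
    contMDiffAt_const.prodMk contMDiffAt_id
  exact (contMDiffAt_uncurry hF ht y).comp y h1

omit [(ofRiemannian h).HasLeviCivita] [IsManifold (𝓡 3) ∞ X] [IsManifold (𝓡 2) ∞ S] in
/-- Each slice of a smooth family is differentiable. [folklore] -/
theorem mdifferentiableAt_slice
    (hF : ContMDiffOn (𝓘(ℝ, ℝ).prod (𝓡 2)) (𝓡 3) ∞ (fun q : ℝ × S ↦ F q.1 q.2) (Ioo a b ×ˢ univ))
    {t : ℝ} (ht : t ∈ Ioo a b) (y : S) : MDifferentiableAt (𝓡 2) (𝓡 3) (F t) y :=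
  (contMDiffAt_slice hF ht y).mdifferentiableAt (by simp)

omit [(ofRiemannian h).HasLeviCivita] [IsManifold (𝓡 3) ∞ X] [IsManifold (𝓡 2) ∞ S] in
/-- The time curve `t ↦ F t y` of a smooth family is smooth at every `t ∈ (a, b)`. [folklore] -/
theorem contMDiffAt_time
    (hF : ContMDiffOn (𝓘(ℝ, ℝ).prod (𝓡 2)) (𝓡 3) ∞ (fun q : ℝ × S ↦ F q.1 q.2) (Ioo a b ×ˢ univ))
    {t : ℝ} (ht : t ∈ Ioo a b) (y : S) : ContMDiffAt 𝓘(ℝ, ℝ) (𝓡 3) ∞ (fun s ↦ F s y) t := by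
  have h1 : ContMDiffAt 𝓘(ℝ, ℝ) (𝓘(ℝ, ℝ).prod (𝓡 2)) ∞ (fun s : ℝ ↦ ((s, y) : ℝ × S)) t :=
    contMDiffAt_id.prodMk contMDiffAt_const
  exact (contMDiffAt_uncurry hF ht y).comp t h1

omit [(ofRiemannian h).HasLeviCivita] [IsManifold (𝓡 3) ∞ X] in
/-- **The family read in a chart of `S` is smooth**: `(t, u) ↦ F t (φ⁻¹ u)`, `φ` the extended
chart of `S` at `y₀`, is `C^∞` on `(a, b) × φ.target`, as a map from the normed space `ℝ × ℝ²`.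
[folklore] -/
theorem contMDiffOn_chartFamily
    (hF : ContMDiffOn (𝓘(ℝ, ℝ).prod (𝓡 2)) (𝓡 3) ∞ (fun q : ℝ × S ↦ F q.1 q.2) (Ioo a b ×ˢ univ))
    (y₀ : S) :
    ContMDiffOn 𝓘(ℝ, ℝ × EuclideanSpace ℝ (Fin 2)) (𝓡 3) ∞
      (fun q : ℝ × EuclideanSpace ℝ (Fin 2) ↦ F q.1 ((extChartAt (𝓡 2) y₀).symm q.2))
      (Ioo a b ×ˢ (extChartAt (𝓡 2) y₀).target) := by
  have hG : ContMDiffOn (𝓘(ℝ, ℝ).prod 𝓘(ℝ, EuclideanSpace ℝ (Fin 2))) (𝓘(ℝ, ℝ).prod (𝓡 2)) ∞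
      (fun q : ℝ × EuclideanSpace ℝ (Fin 2) ↦ ((q.1, (extChartAt (𝓡 2) y₀).symm q.2) : ℝ × S))
      (Ioo a b ×ˢ (extChartAt (𝓡 2) y₀).target) :=
    contMDiffOn_fst.prodMk ((contMDiffOn_extChartAt_symm y₀).comp contMDiffOn_snd
      fun q hq ↦ hq.2)
  have hmaps : MapsTo (fun q : ℝ × EuclideanSpace ℝ (Fin 2) ↦
      ((q.1, (extChartAt (𝓡 2) y₀).symm q.2) : ℝ × S))
      (Ioo a b ×ˢ (extChartAt (𝓡 2) y₀).target) (Ioo a b ×ˢ univ) :=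
    fun q hq ↦ ⟨hq.1, mem_univ _⟩
  have h1 : ContMDiffOn (𝓘(ℝ, ℝ).prod 𝓘(ℝ, EuclideanSpace ℝ (Fin 2))) (𝓡 3) ∞
      (fun q : ℝ × EuclideanSpace ℝ (Fin 2) ↦ F q.1 ((extChartAt (𝓡 2) y₀).symm q.2))
      (Ioo a b ×ˢ (extChartAt (𝓡 2) y₀).target) := hF.comp hG hmaps
  rw [modelWithCornersSelf_prod, ← chartedSpaceSelf_prod]
  exact h1

omit [(ofRiemannian h).HasLeviCivita] [IsManifold (𝓡 3) ∞ X] in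
/-- The two-parameter map `(t, σ) ↦ F t (c σ)`, `c = curveThrough (𝓡 2) p v` the chart-straight
curve, is `C^∞` at every `(t, σ)` with `t ∈ (a, b)` and `φ p + σ v` in the chart target (in
particular at `(t, 0)`). O'Neill 1983, Ch. 4, p. 122 (two-parameter maps). [folklore] -/
theorem contMDiffAt_uncurry_curveThrough
    (hF : ContMDiffOn (𝓘(ℝ, ℝ).prod (𝓡 2)) (𝓡 3) ∞ (fun q : ℝ × S ↦ F q.1 q.2) (Ioo a b ×ˢ univ))
    {t : ℝ} (ht : t ∈ Ioo a b) (p : S) (v : TangentSpace (𝓡 2) p) {σ : ℝ}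
    (hσ : extChartAt (𝓡 2) p p + σ • (show EuclideanSpace ℝ (Fin 2) from v) ∈
      (extChartAt (𝓡 2) p).target) :
    ContMDiffAt (𝓘(ℝ, ℝ).prod 𝓘(ℝ, ℝ)) (𝓡 3) ∞
      (uncurry fun t' s ↦ F t' (curveThrough (𝓡 2) p v s)) (t, σ) := by
  have hc : ContMDiffAt 𝓘(ℝ, ℝ) (𝓡 2) ∞ (curveThrough (𝓡 2) p v) σ :=
    contMDiffAt_curveThrough p v hσ
  have h1 : ContMDiffAt (𝓘(ℝ, ℝ).prod 𝓘(ℝ, ℝ)) (𝓘(ℝ, ℝ).prod (𝓡 2)) ∞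
      (fun q : ℝ × ℝ ↦ ((q.1, curveThrough (𝓡 2) p v q.2) : ℝ × S)) (t, σ) :=
    contMDiffAt_fst.prodMk
      (ContMDiffAt.comp (t, σ) (g := curveThrough (𝓡 2) p v) (f := Prod.snd) hc contMDiffAt_snd)
  exact (contMDiffAt_uncurry hF ht (curveThrough (𝓡 2) p v σ)).comp (t, σ) h1

omit [(ofRiemannian h).HasLeviCivita] [IsManifold (𝓡 3) ∞ X] in
/-- The two-parameter map `(t, σ) ↦ F t (c σ)` is `C²` at `(t, 0)`. [folklore] -/
theorem contMDiffAt_uncurry_curveThrough_zero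
    (hF : ContMDiffOn (𝓘(ℝ, ℝ).prod (𝓡 2)) (𝓡 3) ∞ (fun q : ℝ × S ↦ F q.1 q.2) (Ioo a b ×ˢ univ))
    {t : ℝ} (ht : t ∈ Ioo a b) (p : S) (v : TangentSpace (𝓡 2) p) :
    ContMDiffAt (𝓘(ℝ, ℝ).prod 𝓘(ℝ, ℝ)) (𝓡 3) 2
      (uncurry fun t' s ↦ F t' (curveThrough (𝓡 2) p v s)) (t, 0) :=
  (contMDiffAt_uncurry_curveThrough hF ht p v (σ := 0) (by simp)).of_le (by decide)

omit [(ofRiemannian h).HasLeviCivita] [IsManifold (𝓡 3) ∞ X] in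
/-- The `σ`-velocity at `σ = 0` of `σ ↦ F t (c σ)`, `c` the chart-straight curve through `p` with
velocity `v`, is `dF_t(v)`. O'Neill 1983, Ch. 4, p. 122 (`x_v = dx(∂_v)`).
[cite: ONeill1983, Ch. 4, p. 122] -/
theorem velocity_comp_curveThrough
    (hF : ContMDiffOn (𝓘(ℝ, ℝ).prod (𝓡 2)) (𝓡 3) ∞ (fun q : ℝ × S ↦ F q.1 q.2) (Ioo a b ×ˢ univ))
    {t : ℝ} (ht : t ∈ Ioo a b) (p : S) (v : TangentSpace (𝓡 2) p) :
    (velocity (𝓡 3) (fun s ↦ F t (curveThrough (𝓡 2) p v s)) 0 : E3) =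
      mfderiv (𝓡 2) (𝓡 3) (F t) p v := by
  have hc : MDifferentiableAt 𝓘(ℝ, ℝ) (𝓡 2) (curveThrough (𝓡 2) p v) 0 :=
    (contMDiffAt_curveThrough_zero (n := 1) p v).mdifferentiableAt one_ne_zero
  have hv : velocity (𝓡 2) (curveThrough (𝓡 2) p v) 0 = v :=
    velocity_curveThrough_zero_holds BoundarylessManifold.isInteriorPoint v
  have h1 := mfderiv_comp_apply_of_eq (hg := mdifferentiableAt_slice hF ht p) (hf := hc)
    (hy := curveThrough_zero (𝓡 2) p v) (v := (1 : ℝ))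
  exact h1.trans (congrArg (mfderiv (𝓡 2) (𝓡 3) (F t) p) hv)

omit [(ofRiemannian h).HasLeviCivita] in
/-- **The variation field `∂ₜF` along the two-parameter map is a smooth map into `TX`.** For
`t ∈ (a, b)` and `σ` with `φ p + σ v` in the chart target, the lift
`(t', σ') ↦ (F t' (c σ'), ∂ₜF(t', c σ')) ∈ TX` is `C^∞` at `(t, σ)`: with the family read in the
chart, `P(t', u) = F t' (φ⁻¹ u)`, it is `q ↦ (P q, dP_q(1, 0))` (`contMDiffAt_lift_mfderiv_const`)
composed with `(t', σ') ↦ (t', φ p + σ' v)`. O'Neill 1983, Ch. 4, p. 122 (the partial velocity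
`x_u` is a smooth vector field on `x`). [cite: ONeill1983, Ch. 4, p. 122] -/
theorem contMDiffAt_lift_tvelocity
    (hF : ContMDiffOn (𝓘(ℝ, ℝ).prod (𝓡 2)) (𝓡 3) ∞ (fun q : ℝ × S ↦ F q.1 q.2) (Ioo a b ×ˢ univ))
    {t : ℝ} (ht : t ∈ Ioo a b) (p : S) (v : TangentSpace (𝓡 2) p) {σ : ℝ}
    (hσ : extChartAt (𝓡 2) p p + σ • (show EuclideanSpace ℝ (Fin 2) from v) ∈
      (extChartAt (𝓡 2) p).target) :
    ContMDiffAt (𝓘(ℝ, ℝ).prod 𝓘(ℝ, ℝ)) (𝓡 3).tangent ∞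
      (fun q : ℝ × ℝ ↦ (TotalSpace.mk' E3 (F q.1 (curveThrough (𝓡 2) p v q.2))
        (velocity (𝓡 3) (fun t' ↦ F t' (curveThrough (𝓡 2) p v q.2)) q.1) :
          TangentBundle (𝓡 3) X)) (t, σ) := by
  set D : Set (ℝ × EuclideanSpace ℝ (Fin 2)) := Ioo a b ×ˢ (extChartAt (𝓡 2) p).target with hD
  have hDo : IsOpen D := isOpen_Ioo.prod (isOpen_extChartAt_target p)
  have hP := contMDiffOn_chartFamily hF p
  set ψ : ℝ × ℝ → ℝ × EuclideanSpace ℝ (Fin 2) := fun q ↦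
    (q.1, extChartAt (𝓡 2) p p + q.2 • (show EuclideanSpace ℝ (Fin 2) from v)) with hψ
  have hq : ψ (t, σ) ∈ D := ⟨ht, hσ⟩
  have hψc : ContMDiffAt (𝓘(ℝ, ℝ).prod 𝓘(ℝ, ℝ)) (𝓘(ℝ, ℝ).prod 𝓘(ℝ, EuclideanSpace ℝ (Fin 2))) ∞
      ψ (t, σ) :=
    (contMDiffAt_fst (I := 𝓘(ℝ, ℝ)) (J := 𝓘(ℝ, ℝ))).prodMk
      ((contMDiffAt_const (I := 𝓘(ℝ, ℝ).prod 𝓘(ℝ, ℝ))).add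
        ((contMDiffAt_snd (I := 𝓘(ℝ, ℝ)) (J := 𝓘(ℝ, ℝ))).smul
          (contMDiffAt_const (I := 𝓘(ℝ, ℝ).prod 𝓘(ℝ, ℝ)))))
  have hψcont : ContinuousAt ψ (t, σ) := hψc.continuousAt
  -- the smooth lift `q ↦ (P q, dP_q (1, 0))`
  have hL := contMDiffAt_lift_mfderiv_const hDo hP hq ((1 : ℝ), (0 : EuclideanSpace ℝ (Fin 2)))
  have hL' : ContMDiffAt (𝓘(ℝ, ℝ).prod 𝓘(ℝ, EuclideanSpace ℝ (Fin 2))) (𝓡 3).tangent ∞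
      (fun q' : ℝ × EuclideanSpace ℝ (Fin 2) ↦ (TotalSpace.mk' E3
        (F q'.1 ((extChartAt (𝓡 2) p).symm q'.2))
        (mfderiv 𝓘(ℝ, ℝ × EuclideanSpace ℝ (Fin 2)) (𝓡 3)
          (fun q : ℝ × EuclideanSpace ℝ (Fin 2) ↦ F q.1 ((extChartAt (𝓡 2) p).symm q.2)) q'
          ((1 : ℝ), (0 : EuclideanSpace ℝ (Fin 2)))) : TangentBundle (𝓡 3) X)) (ψ (t, σ)) := by
    rw [← modelWithCornersSelf_prod, chartedSpaceSelf_prod]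
    exact hL
  have hcomp := hL'.comp (t, σ) hψc
  -- near `(t, σ)` the velocity is that differential
  have hev : ∀ᶠ q in 𝓝 (t, σ), ψ q ∈ D := hψcont.preimage_mem_nhds (hDo.mem_nhds hq)
  refine hcomp.congr_of_eventuallyEq ?_
  filter_upwards [hev] with q hqD
  have hPd : MDifferentiableAt 𝓘(ℝ, ℝ × EuclideanSpace ℝ (Fin 2)) (𝓡 3)
      (fun q : ℝ × EuclideanSpace ℝ (Fin 2) ↦ F q.1 ((extChartAt (𝓡 2) p).symm q.2)) (ψ q) :=
    (hP.contMDiffAt (hDo.mem_nhds hqD)).mdifferentiableAt (by simp)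
  have hvel := IsClassicalIMCF.velocity_eq_mfderiv_chartFlow (F := F) (y₀ := p) (t := q.1)
    (u := extChartAt (𝓡 2) p p + q.2 • (show EuclideanSpace ℝ (Fin 2) from v)) hPd
  show (TotalSpace.mk' E3 (F q.1 (curveThrough (𝓡 2) p v q.2))
      (velocity (𝓡 3) (fun t' ↦ F t' (curveThrough (𝓡 2) p v q.2)) q.1) :
        TangentBundle (𝓡 3) X) = _
  simp only [Function.comp_apply]
  unfold curveThrough
  rw [hvel]


/-! ### The variation field `∂ₜF` and the acceleration field `D_t ∂ₜF` of a family -/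

end SurfaceVariation

section Fields

variable {E : Type*} [NormedAddCommGroup E] [NormedSpace ℝ E] {H : Type*} [TopologicalSpace H]
  (I : ModelWithCorners ℝ E H) {M : Type*} [TopologicalSpace M] [ChartedSpace H M]
  {N : Type*}

/-- The **variation field** `∂ₜF(t, ·)` of a one-parameter family of maps `F : ℝ → N → M` at the
time `t`: the field `y ↦ ∂ₜF(t, y) ∈ T_{F t y} M` along `F t` (velocity of the time curve
`s ↦ F s y` at `s = t`). O'Neill 1983, Ch. 4, p. 122 (the partial velocity `x_u` of a
two-parameter map; Ch. 10, pp. 215–216, variations of a curve segment and their variation vector fields); Lawson 1980, Ch. I §7.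
[cite: ONeill1983, Ch. 4, p. 122] -/
def tvelocity (F : ℝ → N → M) (t : ℝ) : Π y : N, TangentSpace I (F t y) :=
  fun y ↦ velocity I (fun s ↦ F s y) t

/-- Unfolding lemma for `tvelocity`. [folklore] -/
@[simp]
lemma tvelocity_apply (F : ℝ → N → M) (t : ℝ) (y : N) :
    tvelocity I F t y = velocity I (fun s ↦ F s y) t := rfl

variable [IsManifold I ∞ M] [FiniteDimensional ℝ E]

/-- The **acceleration field** `D_t ∂ₜF (t, ·)` of a one-parameter family `F : ℝ → N → M` at the
time `t` with respect to a covariant derivative `cov` on `TM`: the covariant derivative, along the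
time curve `s ↦ F s y`, of its velocity field, at `s = t` (so the time curves are geodesics iff the
acceleration field vanishes). O'Neill 1983, Ch. 3, Def. 3.19 ff. (acceleration `α''` of a curve)
and Ch. 4, p. 122; Lawson 1980, Ch. I §7 (the term `∇_E E` of the second variation formula).
[cite: ONeill1983, Ch. 4, p. 122] -/
def acceleration (cov : CovariantDerivative I E (TangentSpace I : M → Type _)) (F : ℝ → N → M)
    (t : ℝ) : Π y : N, TangentSpace I (F t y) :=
  fun y ↦ covariantDerivAlong cov (fun s ↦ F s y) (fun s ↦ tvelocity I F s y) t

/-- Unfolding lemma for `acceleration`. [folklore] -/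
lemma acceleration_apply (cov : CovariantDerivative I E (TangentSpace I : M → Type _))
    (F : ℝ → N → M) (t : ℝ) (y : N) :
    acceleration I cov F t y =
      covariantDerivAlong cov (fun s ↦ F s y) (fun s ↦ tvelocity I F s y) t := rfl

end Fields

namespace SurfaceVariation

variable {X : Type*} [TopologicalSpace X] [ChartedSpace E3 X] [IsManifold (𝓡 3) ∞ X]
  {h : ContMDiffRiemannianMetric (𝓡 3) ∞ E3 (TangentSpace (𝓡 3) : X → Type _)}
  [(ofRiemannian h).HasLeviCivita]
  {S : Type*} [TopologicalSpace S] [ChartedSpace (EuclideanSpace ℝ (Fin 2)) S]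
  [IsManifold (𝓡 2) ∞ S]
  {F : ℝ → S → X} {a b : ℝ}

/-! ### The fields `dF_τ(v)` and `P_v(τ) = D_v ∂ₜF(τ, ·)` along the time curve `τ ↦ F τ p` -/

/-- The lift `τ ↦ (F τ p, ∂_σ|₀ F τ (c σ)) ∈ TX` of the `σ`-velocity of the two-parameter map
through the chart-straight curve `c` at `p` with velocity `v` is differentiable at every
`t ∈ (a, b)` (`mdifferentiableAt_lift_velocity_curry_right`). O'Neill 1983, Ch. 4, p. 122.
[cite: ONeill1983, Ch. 4, p. 122] -/
theorem mdifferentiableAt_lift_svelocity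
    (hF : ContMDiffOn (𝓘(ℝ, ℝ).prod (𝓡 2)) (𝓡 3) ∞ (fun q : ℝ × S ↦ F q.1 q.2) (Ioo a b ×ˢ univ))
    {t : ℝ} (ht : t ∈ Ioo a b) (p : S) (v : TangentSpace (𝓡 2) p) :
    MDifferentiableAt 𝓘(ℝ, ℝ) (𝓡 3).tangent
      (fun τ ↦ (TotalSpace.mk' E3 (F τ p)
        (velocity (𝓡 3) (fun s ↦ F τ (curveThrough (𝓡 2) p v s)) 0 : E3) :
          TangentBundle (𝓡 3) X)) t := by
  have hbase : (fun t' ↦ (fun t' s ↦ F t' (curveThrough (𝓡 2) p v s)) t' 0) = fun t' ↦ F t' p := by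
    funext t'
    simp [curveThrough_zero]
  exact mdifferentiableAt_lift_congr_base hbase
    (mdifferentiableAt_lift_velocity_curry_right (contMDiffAt_uncurry_curveThrough_zero hF ht p v))

set_option maxHeartbeats 400000 in
/-- **`D_t dF(v) = D_v ∂ₜF`** (symmetry lemma, O'Neill 1983, Ch. 4, Prop. 4.44 (1)): the
covariant derivative at `τ ∈ (a, b)`, along the time curve `τ ↦ F τ p`, of the `σ`-velocity field
of the two-parameter map `(τ, σ) ↦ F τ (c σ)` (`c` the chart-straight curve at `p` with velocity
`v`) equals the covariant derivative at `σ = 0`, along `σ ↦ F τ (c σ)`, of the variation field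
`∂ₜF(τ, c σ)`. [cite: ONeill1983, Ch. 4, Prop. 44 (1)] -/
theorem covariantDerivAlong_svelocity_eq
    (hF : ContMDiffOn (𝓘(ℝ, ℝ).prod (𝓡 2)) (𝓡 3) ∞ (fun q : ℝ × S ↦ F q.1 q.2) (Ioo a b ×ˢ univ))
    {t : ℝ} (ht : t ∈ Ioo a b) (p : S) (v : TangentSpace (𝓡 2) p) :
    (covariantDerivAlong (ofRiemannian h).leviCivita (fun τ ↦ F τ p)
        (fun τ ↦ (velocity (𝓡 3) (fun s ↦ F τ (curveThrough (𝓡 2) p v s)) 0 :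
          TangentSpace (𝓡 3) (F τ p))) t : E3) =
      covariantDerivAlong (ofRiemannian h).leviCivita (fun s ↦ F t (curveThrough (𝓡 2) p v s))
        (fun s ↦ tvelocity (𝓡 3) F t (curveThrough (𝓡 2) p v s)) 0 := by
  set cov := (ofRiemannian h).leviCivita with hcov
  have hLC := isLeviCivita_leviCivita_holds (g := ofRiemannian h)
  have hbase : (fun t' ↦ (fun t' s ↦ F t' (curveThrough (𝓡 2) p v s)) t' 0) = fun t' ↦ F t' p := by
    funext t'
    simp [curveThrough_zero]
  have key := covariantDerivAlong_velocity_comm cov hLC.1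
    (x := fun t' s ↦ F t' (curveThrough (𝓡 2) p v s)) (t₀ := t) (s₀ := 0)
    (contMDiffAt_uncurry_curveThrough_zero hF ht p v)
  rw [← covariantDerivAlong_congr_base cov hbase
    (fun τ ↦ (velocity (𝓡 3) (fun s ↦ F τ (curveThrough (𝓡 2) p v s)) 0 : E3)) t]
  exact key

/-- The lift `τ ↦ (F τ p, P_v(τ)) ∈ TX` of the field `P_v(τ) = D_v ∂ₜF(τ, ·)` (covariant
derivative at `σ = 0` of the variation field along `σ ↦ F τ (c σ)`) is differentiable at every
`t ∈ (a, b)` (`mdifferentiableAt_lift_covariantDerivAlong_curry_right`, the variation field being a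
smooth map into `TX` along the two-parameter map, `contMDiffAt_lift_tvelocity`).
[cite: ONeill1983, Ch. 4, p. 123] -/
theorem mdifferentiableAt_lift_P
    (hF : ContMDiffOn (𝓘(ℝ, ℝ).prod (𝓡 2)) (𝓡 3) ∞ (fun q : ℝ × S ↦ F q.1 q.2) (Ioo a b ×ˢ univ))
    {t : ℝ} (ht : t ∈ Ioo a b) (p : S) (v : TangentSpace (𝓡 2) p) :
    MDifferentiableAt 𝓘(ℝ, ℝ) (𝓡 3).tangent
      (fun τ ↦ (TotalSpace.mk' E3 (F τ p)
        (covariantDerivAlong (ofRiemannian h).leviCivita (fun s ↦ F τ (curveThrough (𝓡 2) p v s))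
          (fun s ↦ tvelocity (𝓡 3) F τ (curveThrough (𝓡 2) p v s)) 0 : E3) :
          TangentBundle (𝓡 3) X)) t := by
  set g := ofRiemannian h with hg
  set x : ℝ → ℝ → X := fun t' s ↦ F t' (curveThrough (𝓡 2) p v s) with hx
  have hx2 : ContMDiffAt (𝓘(ℝ, ℝ).prod 𝓘(ℝ, ℝ)) (𝓡 3) 2 (uncurry x) (t, 0) :=
    contMDiffAt_uncurry_curveThrough_zero hF ht p v
  have hZ : ContMDiffAt (𝓘(ℝ, ℝ).prod 𝓘(ℝ, ℝ)) (𝓡 3).tangent 2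
      (fun q : ℝ × ℝ ↦ (TotalSpace.mk' E3 (x q.1 q.2) (tvelocity (𝓡 3) F q.1
        (curveThrough (𝓡 2) p v q.2)) : TangentBundle (𝓡 3) X)) (t, 0) :=
    (contMDiffAt_lift_tvelocity hF ht p v (σ := 0) (by simp)).of_le
      (show (2 : WithTop ℕ∞) ≤ ∞ by exact WithTop.coe_le_coe.2 le_top)
  have h1 := mdifferentiableAt_lift_covariantDerivAlong_curry_right (cov := g.leviCivita)
    (x := x) (Z := fun t' s ↦ tvelocity (𝓡 3) F t' (curveThrough (𝓡 2) p v s)) (t := t) (s := 0)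
    (g.isLocallyContMDiff_leviCivita_holds 1 (by exact_mod_cast le_top)) hx2 hZ
  have hbase : (fun t' ↦ x t' 0) = fun t' ↦ F t' p := by
    funext t'
    simp [hx, curveThrough_zero]
  exact mdifferentiableAt_lift_congr_base hbase h1

/-- **First derivative of the induced metric**: for `t ∈ (a, b)`, `p ∈ S` and `v, w ∈ T_p S`,
`τ ↦ (F_τ^*h)_p(v, w) = h(dF_τ v, dF_τ w)` has derivative `h(P_v, dF_t w) + h(dF_t v, P_w)` at
`t`, `P_v = D_v ∂ₜF(t, ·)` (metric compatibility along `τ ↦ F τ p`, `hasDerivAt_val_apply_along`,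
and `covariantDerivAlong_svelocity_eq`). For a normal speed `∂ₜF = f ν` this is the classical
`∂ₜ gᵢⱼ = 2 f Kᵢⱼ` (Huisken–Polden 1999, Thm. 3.2 (i)); no normality is needed here.
[cite: ONeill1983, Ch. 3, Prop. 18 (3) and Ch. 4, Prop. 44 (1)] -/
theorem hasDerivAt_val_mfderiv
    (hF : ContMDiffOn (𝓘(ℝ, ℝ).prod (𝓡 2)) (𝓡 3) ∞ (fun q : ℝ × S ↦ F q.1 q.2) (Ioo a b ×ˢ univ))
    {t : ℝ} (ht : t ∈ Ioo a b) (p : S) (v w : TangentSpace (𝓡 2) p) :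
    HasDerivAt (fun τ ↦ (ofRiemannian h).val (F τ p) (mfderiv (𝓡 2) (𝓡 3) (F τ) p v)
        (mfderiv (𝓡 2) (𝓡 3) (F τ) p w))
      ((ofRiemannian h).val (F t p)
          (covariantDerivAlong (ofRiemannian h).leviCivita
            (fun s ↦ F t (curveThrough (𝓡 2) p v s))
            (fun s ↦ tvelocity (𝓡 3) F t (curveThrough (𝓡 2) p v s)) 0)
          (mfderiv (𝓡 2) (𝓡 3) (F t) p w) +
        (ofRiemannian h).val (F t p) (mfderiv (𝓡 2) (𝓡 3) (F t) p v)
          (covariantDerivAlong (ofRiemannian h).leviCivita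
            (fun s ↦ F t (curveThrough (𝓡 2) p w s))
            (fun s ↦ tvelocity (𝓡 3) F t (curveThrough (𝓡 2) p w s)) 0)) t := by
  set g := ofRiemannian h with hg
  set cov := g.leviCivita with hcov
  have hLC := isLeviCivita_leviCivita_holds (g := g)
  set Vv : ℝ → E3 := fun τ ↦ velocity (𝓡 3) (fun s ↦ F τ (curveThrough (𝓡 2) p v s)) 0 with hVv
  set Vw : ℝ → E3 := fun τ ↦ velocity (𝓡 3) (fun s ↦ F τ (curveThrough (𝓡 2) p w s)) 0 with hVw
  have hP := g.hasDerivAt_val_apply_along hLC.2 (γ := fun τ ↦ F τ p)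
    (V := fun τ ↦ (Vv τ : TangentSpace (𝓡 3) (F τ p)))
    (W := fun τ ↦ (Vw τ : TangentSpace (𝓡 3) (F τ p)))
    (mdifferentiableAt_lift_svelocity hF ht p v) (mdifferentiableAt_lift_svelocity hF ht p w)
  have hev : ∀ᶠ τ in 𝓝 t, τ ∈ Ioo a b := isOpen_Ioo.mem_nhds ht
  have heq : (fun τ ↦ g.val (F τ p) (Vv τ) (Vw τ)) =ᶠ[𝓝 t] fun τ ↦
      g.val (F τ p) (mfderiv (𝓡 2) (𝓡 3) (F τ) p v) (mfderiv (𝓡 2) (𝓡 3) (F τ) p w) := by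
    filter_upwards [hev] with τ hτ
    simp only [hVv, hVw]
    rw [velocity_comp_curveThrough hF hτ p v, velocity_comp_curveThrough hF hτ p w]
  refine (hP.congr_of_eventuallyEq heq.symm).congr_deriv ?_
  have hv₀ : Vv t = mfderiv (𝓡 2) (𝓡 3) (F t) p v := velocity_comp_curveThrough hF ht p v
  have hw₀ : Vw t = mfderiv (𝓡 2) (𝓡 3) (F t) p w := velocity_comp_curveThrough hF ht p w
  rw [hw₀, hv₀]
  simp only [hVv, hVw]
  rw [covariantDerivAlong_svelocity_eq hF ht p v, covariantDerivAlong_svelocity_eq hF ht p w]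

/-- **Derivative of `h(P_v, dF w)`**: for `t ∈ (a, b)`, `τ ↦ h(P_v(τ), dF_τ w)` has derivative
`h(D_t P_v, dF_t w) + h(P_v(t), P_w(t))` at `t`, where `D_t P_v` is the covariant derivative of
`τ ↦ P_v(τ)` along the time curve (metric compatibility, `D_t dF(w) = P_w`).
[cite: ONeill1983, Ch. 3, Prop. 18 (3)] -/
theorem hasDerivAt_val_P_mfderiv
    (hF : ContMDiffOn (𝓘(ℝ, ℝ).prod (𝓡 2)) (𝓡 3) ∞ (fun q : ℝ × S ↦ F q.1 q.2) (Ioo a b ×ˢ univ))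
    {t : ℝ} (ht : t ∈ Ioo a b) (p : S) (v w : TangentSpace (𝓡 2) p) :
    HasDerivAt (fun τ ↦ (ofRiemannian h).val (F τ p)
        (covariantDerivAlong (ofRiemannian h).leviCivita (fun s ↦ F τ (curveThrough (𝓡 2) p v s))
          (fun s ↦ tvelocity (𝓡 3) F τ (curveThrough (𝓡 2) p v s)) 0)
        (mfderiv (𝓡 2) (𝓡 3) (F τ) p w))
      ((ofRiemannian h).val (F t p)
          (covariantDerivAlong (ofRiemannian h).leviCivita (fun τ ↦ F τ p)
            (fun τ ↦ (covariantDerivAlong (ofRiemannian h).leviCivita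
              (fun s ↦ F τ (curveThrough (𝓡 2) p v s))
              (fun s ↦ tvelocity (𝓡 3) F τ (curveThrough (𝓡 2) p v s)) 0 :
                TangentSpace (𝓡 3) (F τ p))) t)
          (mfderiv (𝓡 2) (𝓡 3) (F t) p w) +
        (ofRiemannian h).val (F t p)
          (covariantDerivAlong (ofRiemannian h).leviCivita (fun s ↦ F t (curveThrough (𝓡 2) p v s))
            (fun s ↦ tvelocity (𝓡 3) F t (curveThrough (𝓡 2) p v s)) 0)
          (covariantDerivAlong (ofRiemannian h).leviCivita (fun s ↦ F t (curveThrough (𝓡 2) p w s))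
            (fun s ↦ tvelocity (𝓡 3) F t (curveThrough (𝓡 2) p w s)) 0)) t := by
  set g := ofRiemannian h with hg
  set cov := g.leviCivita with hcov
  have hLC := isLeviCivita_leviCivita_holds (g := g)
  set Pv : ℝ → E3 := fun τ ↦ covariantDerivAlong cov (fun s ↦ F τ (curveThrough (𝓡 2) p v s))
    (fun s ↦ tvelocity (𝓡 3) F τ (curveThrough (𝓡 2) p v s)) 0 with hPv
  set Vw : ℝ → E3 := fun τ ↦ velocity (𝓡 3) (fun s ↦ F τ (curveThrough (𝓡 2) p w s)) 0 with hVw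
  have hP := g.hasDerivAt_val_apply_along hLC.2 (γ := fun τ ↦ F τ p)
    (V := fun τ ↦ (Pv τ : TangentSpace (𝓡 3) (F τ p)))
    (W := fun τ ↦ (Vw τ : TangentSpace (𝓡 3) (F τ p)))
    (mdifferentiableAt_lift_P hF ht p v) (mdifferentiableAt_lift_svelocity hF ht p w)
  have hev : ∀ᶠ τ in 𝓝 t, τ ∈ Ioo a b := isOpen_Ioo.mem_nhds ht
  have heq : (fun τ ↦ g.val (F τ p) (Pv τ) (Vw τ)) =ᶠ[𝓝 t] fun τ ↦
      g.val (F τ p) (Pv τ) (mfderiv (𝓡 2) (𝓡 3) (F τ) p w) := by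
    filter_upwards [hev] with τ hτ
    simp only [hVw]
    rw [velocity_comp_curveThrough hF hτ p w]
  refine (hP.congr_of_eventuallyEq heq.symm).congr_deriv ?_
  have hw₀ : Vw t = mfderiv (𝓡 2) (𝓡 3) (F t) p w := velocity_comp_curveThrough hF ht p w
  rw [hw₀]
  simp only [hVw]
  rw [covariantDerivAlong_svelocity_eq hF ht p w]

/-- **`D_t P_v = D_v a + R(∂ₜF, dF v) ∂ₜF`** (O'Neill 1983, Ch. 4, Prop. 4.44 (2), for the
two-parameter map `x(τ, σ) = F τ (c σ)` and the field `Z = x_τ = ∂ₜF`): the covariant derivative at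
`t` along the time curve of `τ ↦ P_v(τ) = (D_σ x_τ)(τ, 0)` is the covariant derivative at `σ = 0`,
along `σ ↦ F t (c σ)`, of the acceleration field `a = D_τ x_τ` of the family, plus the curvature
`R(∂ₜF, dF_t v) ∂ₜF` at `F t p` (curvature convention of this directory,
`R(X,Y) = ∇_X∇_Y − ∇_Y∇_X − ∇_{[X,Y]}`). [cite: ONeill1983, Ch. 4, Prop. 44 (2)] -/
theorem val_covariantDerivAlong_P_eq
    (hF : ContMDiffOn (𝓘(ℝ, ℝ).prod (𝓡 2)) (𝓡 3) ∞ (fun q : ℝ × S ↦ F q.1 q.2) (Ioo a b ×ˢ univ))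
    {t : ℝ} (ht : t ∈ Ioo a b) (p : S) (v : TangentSpace (𝓡 2) p)
    (W : TangentSpace (𝓡 3) (F t p)) :
    (ofRiemannian h).val (F t p) (covariantDerivAlong (ofRiemannian h).leviCivita (fun τ ↦ F τ p)
        (fun τ ↦ (covariantDerivAlong (ofRiemannian h).leviCivita
          (fun s ↦ F τ (curveThrough (𝓡 2) p v s))
          (fun s ↦ tvelocity (𝓡 3) F τ (curveThrough (𝓡 2) p v s)) 0 :
            TangentSpace (𝓡 3) (F τ p))) t) W =
      (ofRiemannian h).val (F t p)
          (show TangentSpace (𝓡 3) (F t p) from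
            covariantDerivAlong (ofRiemannian h).leviCivita (fun s ↦ F t (curveThrough (𝓡 2) p v s))
              (fun s ↦ acceleration (𝓡 3) (ofRiemannian h).leviCivita F t
                (curveThrough (𝓡 2) p v s)) 0) W +
        (ofRiemannian h).val (F t p)
          ((ofRiemannian h).leviCivita.curvature (F t p) (tvelocity (𝓡 3) F t p)
            (mfderiv (𝓡 2) (𝓡 3) (F t) p v) (tvelocity (𝓡 3) F t p)) W := by
  set g := ofRiemannian h with hg
  set cov := g.leviCivita with hcov
  set x : ℝ → ℝ → X := fun t' s ↦ F t' (curveThrough (𝓡 2) p v s) with hx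
  have hx2 : ContMDiffAt (𝓘(ℝ, ℝ).prod 𝓘(ℝ, ℝ)) (𝓡 3) 2 (uncurry x) (t, 0) :=
    contMDiffAt_uncurry_curveThrough_zero hF ht p v
  have hZ : ContMDiffAt (𝓘(ℝ, ℝ).prod 𝓘(ℝ, ℝ)) (𝓡 3).tangent 2
      (fun q : ℝ × ℝ ↦ (TotalSpace.mk' E3 (x q.1 q.2) (tvelocity (𝓡 3) F q.1
        (curveThrough (𝓡 2) p v q.2)) : TangentBundle (𝓡 3) X)) (t, 0) :=
    (contMDiffAt_lift_tvelocity hF ht p v (σ := 0) (by simp)).of_le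
      (show (2 : WithTop ℕ∞) ≤ ∞ by exact WithTop.coe_le_coe.2 le_top)
  have key := covariantDerivAlong_covariantDerivAlong_sub_eq_curvature cov
    (g.isLocallyContMDiff_leviCivita_holds 1 (by exact_mod_cast le_top)) (x := x)
    (Z := fun t' s ↦ tvelocity (𝓡 3) F t' (curveThrough (𝓡 2) p v s)) (t := t) (s := 0) hx2 hZ
  have hbase : (fun t' ↦ x t' 0) = fun t' ↦ F t' p := by
    funext t'
    simp [hx, curveThrough_zero]
  -- transport of the left-hand side to the base curve `t' ↦ x t' 0`
  have hA : (covariantDerivAlong cov (fun τ ↦ F τ p)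
      (fun τ ↦ (covariantDerivAlong cov (fun s ↦ F τ (curveThrough (𝓡 2) p v s))
        (fun s ↦ tvelocity (𝓡 3) F τ (curveThrough (𝓡 2) p v s)) 0 :
          TangentSpace (𝓡 3) (F τ p))) t : E3) =
      covariantDerivAlong cov (fun t' ↦ x t' 0)
        (fun t' ↦ (covariantDerivAlong cov (x t')
          (fun s ↦ tvelocity (𝓡 3) F t' (curveThrough (𝓡 2) p v s)) 0 :
            TangentSpace (𝓡 3) (x t' 0))) t :=
    (covariantDerivAlong_congr_base cov hbase (fun τ ↦ (covariantDerivAlong cov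
      (fun s ↦ F τ (curveThrough (𝓡 2) p v s))
      (fun s ↦ tvelocity (𝓡 3) F τ (curveThrough (𝓡 2) p v s)) 0 : E3)) t).symm
  -- the curvature term at the base point
  have hxs : (velocity (𝓡 3) (x t) 0 : E3) = mfderiv (𝓡 2) (𝓡 3) (F t) p v :=
    velocity_comp_curveThrough hF ht p v
  have hcurv : (cov.curvature (x t 0) (velocity (𝓡 3) (fun t' ↦ x t' 0) t) (velocity (𝓡 3) (x t) 0)
      (tvelocity (𝓡 3) F t (curveThrough (𝓡 2) p v 0)) : E3) =
      cov.curvature (F t p) (tvelocity (𝓡 3) F t p) (mfderiv (𝓡 2) (𝓡 3) (F t) p v)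
        (tvelocity (𝓡 3) F t p) := by
    have e1 : ∀ y (hy : y = p),
        (cov.curvature (F t y) (velocity (𝓡 3) (fun t' ↦ F t' y) t)
          (velocity (𝓡 3) (x t) 0) (tvelocity (𝓡 3) F t y) : E3) =
        cov.curvature (F t p) (tvelocity (𝓡 3) F t p) (mfderiv (𝓡 2) (𝓡 3) (F t) p v)
          (tvelocity (𝓡 3) F t p) := by
      rintro y rfl
      rw [hxs]
      rfl
    exact e1 _ (curveThrough_zero (𝓡 2) p v)
  -- pairing with `W`
  have final : ∀ A B C : TangentSpace (𝓡 3) (F t p), A - B = C →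
      g.val (F t p) A W = g.val (F t p) B W + g.val (F t p) C W := by
    rintro A B C rfl
    rw [map_sub, _root_.sub_apply]
    ring
  refine final _ _ _ ?_
  rw [hA, ← hcurv]
  exact key


/-! ### At the time `t₀`: normal variation field `∂ₜF(t₀, ·) = f ν` -/

section AtTime

variable {hpb : contMDiff_pullbackBilin (𝓡 3) X (𝓡 2) S ∞} {t₀ : ℝ} {ν : NormalField (𝓡 3) (F t₀)}
  {f : S → ℝ}

/-- **`h(ν, D_v ν) = 0`** for a unit normal field with differentiable lift: differentiate
`h(ν, ν) = 1` along the chart-straight curve with velocity `v`. O'Neill 1983, Ch. 4, Lemma 4.19 ff.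
[cite: ONeill1983, Ch. 4, Lemma 4.19] -/
theorem val_normal_normalDerivAlong
    (hν : ContMDiff (𝓡 2) (𝓡 3).tangent ∞
      (fun y ↦ (TotalSpace.mk' E3 (F t₀ y) (ν y) : TangentBundle (𝓡 3) X)))
    (hun : (ofRiemannian h).IsUnitNormal (𝓡 2) (F t₀) ν 1) (p : S) (v : TangentSpace (𝓡 2) p) :
    (ofRiemannian h).val (F t₀ p) (ν p) ((ofRiemannian h).normalDerivAlong (F t₀) ν p v) = 0 := by
  set g := ofRiemannian h with hg
  set c : ℝ → S := curveThrough (𝓡 2) p v with hc_def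
  have hLC := isLeviCivita_leviCivita_holds (g := g)
  have hc0 : c 0 = p := curveThrough_zero (𝓡 2) p v
  have hνlift : MDifferentiableAt 𝓘(ℝ, ℝ) (𝓡 3).tangent
      (fun s ↦ (TotalSpace.mk' E3 (F t₀ (c s)) (ν (c s)) : TangentBundle (𝓡 3) X)) 0 :=
    ((hν.contMDiffAt).comp 0 (contMDiffAt_curveThrough_zero p v)).mdifferentiableAt (by simp)
  have hd := g.hasDerivAt_val_apply_along hLC.2 (γ := fun s ↦ F t₀ (c s))
    (V := fun s ↦ ν (c s)) (W := fun s ↦ ν (c s)) (t₀ := 0) hνlift hνlift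
  have hconst : (fun s ↦ g.val (F t₀ (c s)) (ν (c s)) (ν (c s))) = fun _ ↦ (1 : ℝ) := by
    funext s; exact hun.val_self (c s)
  rw [hconst] at hd
  have h0 := hd.unique (hasDerivAt_const 0 (1 : ℝ))
  rw [g.symm (F t₀ (c 0))
    (covariantDerivAlong g.leviCivita (fun s ↦ F t₀ (c s)) (fun s ↦ ν (c s)) 0)] at h0
  have key : ∀ z : S, p = z →
      g.val (F t₀ p) (ν p) (g.normalDerivAlong (F t₀) ν p v) =
      g.val (F t₀ z) (ν z) (show TangentSpace (𝓡 3) (F t₀ z) from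
        covariantDerivAlong g.leviCivita (fun s ↦ F t₀ (c s)) (fun s ↦ ν (c s)) 0) := by
    rintro z rfl; rfl
  rw [key _ hc0.symm]
  change g.val (F t₀ (c 0)) (ν (c 0))
    (covariantDerivAlong g.leviCivita (fun s ↦ F t₀ (c s)) (fun s ↦ ν (c s)) 0) = 0
  linarith

/-- **`P_v(t₀) = (v f) ν + f D_v ν` for a normal variation field `∂ₜF(t₀, ·) = f ν`**: the
covariant derivative at `σ = 0`, along `σ ↦ F t₀ (c σ)`, of the variation field
`∂ₜF(t₀, c σ) = f(c σ) ν(c σ)` is `df_p(v) ν(p) + f(p) D_v ν` (Leibniz rule,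
`covariantDerivAlong_smul_holds`; `(f ∘ c)'(0) = df_p(v)` by `velocity_curveThrough_zero`). This is
the computation `D_t dF(v) = D_v(f ν) = (vf) ν + f D_v ν` of Huisken–Polden 1999, Thm. 3.2.
[cite: ONeill1983, Ch. 3, Prop. 18 (2)] -/
theorem covariantDerivAlong_tvelocity_eq
    (hν : ContMDiff (𝓡 2) (𝓡 3).tangent ∞
      (fun y ↦ (TotalSpace.mk' E3 (F t₀ y) (ν y) : TangentBundle (𝓡 3) X)))
    (hf : ContMDiff (𝓡 2) 𝓘(ℝ, ℝ) 1 f) (hvel : ∀ y, tvelocity (𝓡 3) F t₀ y = f y • ν y)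
    (p : S) (v : TangentSpace (𝓡 2) p) :
    (covariantDerivAlong (ofRiemannian h).leviCivita (fun s ↦ F t₀ (curveThrough (𝓡 2) p v s))
        (fun s ↦ tvelocity (𝓡 3) F t₀ (curveThrough (𝓡 2) p v s)) 0 : E3) =
      mvfderiv (𝓡 2) f p v • (ν p : E3) +
        f p • ((ofRiemannian h).normalDerivAlong (F t₀) ν p v : E3) := by
  set g := ofRiemannian h with hg
  set cov := g.leviCivita with hcov
  set c : ℝ → S := curveThrough (𝓡 2) p v with hc_def
  have hc0 : c 0 = p := curveThrough_zero (𝓡 2) p v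
  have hcs : MDifferentiableAt 𝓘(ℝ, ℝ) (𝓡 2) c 0 :=
    (contMDiffAt_curveThrough_zero (n := 1) p v).mdifferentiableAt one_ne_zero
  have hνlift : MDifferentiableAt 𝓘(ℝ, ℝ) (𝓡 3).tangent
      (fun s ↦ (TotalSpace.mk' E3 (F t₀ (c s)) (ν (c s)) : TangentBundle (𝓡 3) X)) 0 :=
    ((hν.contMDiffAt).comp 0 (contMDiffAt_curveThrough_zero p v)).mdifferentiableAt (by simp)
  have hW : (fun s ↦ tvelocity (𝓡 3) F t₀ (c s)) = fun s ↦ f (c s) • ν (c s) := by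
    funext s; exact hvel (c s)
  -- `(f ∘ c)'(0) = df_p(v)`
  have hfc : HasDerivAt (fun s ↦ f (c s)) (mfderiv (𝓡 2) 𝓘(ℝ, ℝ) f (c 0) (velocity (𝓡 2) c 0)) 0 :=
    hasDerivAt_comp_curve ((hf (c 0)).mdifferentiableAt one_ne_zero) hcs
  have hvc : velocity (𝓡 2) c 0 = v :=
    velocity_curveThrough_zero_holds BoundarylessManifold.isInteriorPoint v
  have hderiv : deriv (fun s ↦ f (c s)) 0 = mvfderiv (𝓡 2) f p v := by
    rw [hfc.deriv]
    have key : ∀ z : S, z = p → ∀ u : TangentSpace (𝓡 2) z, (show EuclideanSpace ℝ (Fin 2) from u) =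
        (show EuclideanSpace ℝ (Fin 2) from v) →
        mvfderiv (𝓡 2) f z u = mvfderiv (𝓡 2) f p v := by
      rintro z rfl u rfl; rfl
    exact key _ hc0 _ hvc
  have hLeib := covariantDerivAlong_smul_holds cov (γ := fun s ↦ F t₀ (c s))
    (W := fun s ↦ ν (c s)) (f := fun s ↦ f (c s)) (t₀ := 0) hfc.differentiableAt hνlift
  rw [hW, hLeib, hderiv]
  have key : ∀ z : S, z = p →
      mvfderiv (𝓡 2) f p v • (show E3 from ν z) + f z • (show E3 from
        covariantDerivAlong cov (fun s ↦ F t₀ (c s)) (fun s ↦ ν (c s)) 0) =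
      mvfderiv (𝓡 2) f p v • (ν p : E3) +
        f p • (g.normalDerivAlong (F t₀) ν p v : E3) := by
    rintro z rfl; rfl
  exact key _ hc0

/-- **`h(P_v(t₀), dF w) = f K(v, w)`**: with `P_v = (vf) ν + f D_v ν`, `ν ⊥ dF w` and
`K(v, w) = h(D_v ν, dF w)` (`secondFundamentalForm_apply_holds`); hence
`∂ₜ (F_t^*h)(v, w)|_{t₀} = 2 f K(v, w)`. Huisken–Polden 1999, Thm. 3.2 (i)
(`∂ₜ gᵢⱼ = 2 f hᵢⱼ`). [cite: ONeill1983, Ch. 4, Lemma 4.4] -/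
theorem val_P_mfderiv_eq
    (hν : ContMDiff (𝓡 2) (𝓡 3).tangent ∞
      (fun y ↦ (TotalSpace.mk' E3 (F t₀ y) (ν y) : TangentBundle (𝓡 3) X)))
    (hun : (ofRiemannian h).IsUnitNormal (𝓡 2) (F t₀) ν 1)
    (hf : ContMDiff (𝓡 2) 𝓘(ℝ, ℝ) 1 f) (hvel : ∀ y, tvelocity (𝓡 3) F t₀ y = f y • ν y)
    (p : S) (v w : TangentSpace (𝓡 2) p) :
    (ofRiemannian h).val (F t₀ p)
        (covariantDerivAlong (ofRiemannian h).leviCivita (fun s ↦ F t₀ (curveThrough (𝓡 2) p v s))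
          (fun s ↦ tvelocity (𝓡 3) F t₀ (curveThrough (𝓡 2) p v s)) 0)
        (mfderiv (𝓡 2) (𝓡 3) (F t₀) p w) =
      f p * (ofRiemannian h).secondFundamentalForm (𝓡 2) (F t₀) ν p v w := by
  set g := ofRiemannian h with hg
  have hK : g.secondFundamentalForm (𝓡 2) (F t₀) ν p v w =
      g.val (F t₀ p) (g.normalDerivAlong (F t₀) ν p v) (mfderiv (𝓡 2) (𝓡 3) (F t₀) p w) :=
    secondFundamentalForm_apply_holds (g := g) (I' := 𝓡 2) BoundarylessManifold.isInteriorPoint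
      ((hν p).mdifferentiableAt (by simp)) v w
  have hP := covariantDerivAlong_tvelocity_eq (h := h) hν hf hvel p v
  change g.val (F t₀ p) (show TangentSpace (𝓡 3) (F t₀ p) from
    (covariantDerivAlong g.leviCivita (fun s ↦ F t₀ (curveThrough (𝓡 2) p v s))
      (fun s ↦ tvelocity (𝓡 3) F t₀ (curveThrough (𝓡 2) p v s)) 0 : E3)) _ = _
  rw [hP]
  change g.val (F t₀ p) (mvfderiv (𝓡 2) f p v • ν p +
    f p • g.normalDerivAlong (F t₀) ν p v) (mfderiv (𝓡 2) (𝓡 3) (F t₀) p w) = _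
  rw [map_add, map_smul, map_smul, _root_.add_apply, _root_.smul_apply, _root_.smul_apply,
    hun.isNormalTo p w, smul_eq_mul, smul_eq_mul, mul_zero, zero_add, hK]

/-- **`h(P_v(t₀), P_w(t₀)) = (vf)(wf) + f² h(D_v ν, D_w ν)`** (`h(ν, ν) = 1`, `h(ν, D ν) = 0`):
the term `|D E|²` of the second variation for `E = f ν`, split into `|∇f|²` and `f² |A|²` after
tracing. Lawson 1980, Ch. I §7 (proof of Thm. 7.2). [cite: ONeill1983, Ch. 4, Lemma 4.19] -/
theorem val_P_P_eq
    (hν : ContMDiff (𝓡 2) (𝓡 3).tangent ∞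
      (fun y ↦ (TotalSpace.mk' E3 (F t₀ y) (ν y) : TangentBundle (𝓡 3) X)))
    (hun : (ofRiemannian h).IsUnitNormal (𝓡 2) (F t₀) ν 1)
    (hf : ContMDiff (𝓡 2) 𝓘(ℝ, ℝ) 1 f) (hvel : ∀ y, tvelocity (𝓡 3) F t₀ y = f y • ν y)
    (p : S) (v w : TangentSpace (𝓡 2) p) :
    (ofRiemannian h).val (F t₀ p)
        (covariantDerivAlong (ofRiemannian h).leviCivita (fun s ↦ F t₀ (curveThrough (𝓡 2) p v s))
          (fun s ↦ tvelocity (𝓡 3) F t₀ (curveThrough (𝓡 2) p v s)) 0)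
        (covariantDerivAlong (ofRiemannian h).leviCivita (fun s ↦ F t₀ (curveThrough (𝓡 2) p w s))
          (fun s ↦ tvelocity (𝓡 3) F t₀ (curveThrough (𝓡 2) p w s)) 0) =
      mvfderiv (𝓡 2) f p v * mvfderiv (𝓡 2) f p w +
        f p ^ 2 * (ofRiemannian h).val (F t₀ p) ((ofRiemannian h).normalDerivAlong (F t₀) ν p v)
          ((ofRiemannian h).normalDerivAlong (F t₀) ν p w) := by
  have hPv := covariantDerivAlong_tvelocity_eq (h := h) hν hf hvel p v
  have hPw := covariantDerivAlong_tvelocity_eq (h := h) hν hf hvel p w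
  have h0w := val_normal_normalDerivAlong hν hun p w
  have h0v' : (ofRiemannian h).val (F t₀ p) ((ofRiemannian h).normalDerivAlong (F t₀) ν p v) (ν p)
      = 0 := by
    rw [(ofRiemannian h).symm (F t₀ p)]; exact val_normal_normalDerivAlong hν hun p v
  change (ofRiemannian h).val (F t₀ p) (show TangentSpace (𝓡 3) (F t₀ p) from
    (covariantDerivAlong (ofRiemannian h).leviCivita (fun s ↦ F t₀ (curveThrough (𝓡 2) p v s))
      (fun s ↦ tvelocity (𝓡 3) F t₀ (curveThrough (𝓡 2) p v s)) 0 : E3))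
    (show TangentSpace (𝓡 3) (F t₀ p) from
    (covariantDerivAlong (ofRiemannian h).leviCivita (fun s ↦ F t₀ (curveThrough (𝓡 2) p w s))
      (fun s ↦ tvelocity (𝓡 3) F t₀ (curveThrough (𝓡 2) p w s)) 0 : E3)) = _
  rw [hPv, hPw]
  change (ofRiemannian h).val (F t₀ p) (mvfderiv (𝓡 2) f p v • ν p +
    f p • (ofRiemannian h).normalDerivAlong (F t₀) ν p v) (mvfderiv (𝓡 2) f p w • ν p +
    f p • (ofRiemannian h).normalDerivAlong (F t₀) ν p w) = _
  simp only [map_add, map_smul, _root_.add_apply, _root_.smul_apply, smul_eq_mul, hun.val_self p,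
    h0w, h0v']
  ring

omit [TopologicalSpace S] [ChartedSpace (EuclideanSpace ℝ (Fin 2)) S] [IsManifold (𝓡 2) ∞ S] in
/-- **The curvature term**: `h(R(∂ₜF, V) ∂ₜF, W) = f² h(R(ν, V) ν, W)` for `∂ₜF = f ν`
(trilinearity of the curvature tensor). [folklore] -/
theorem val_curvature_tvelocity_eq
    (hvel : ∀ y, tvelocity (𝓡 3) F t₀ y = f y • ν y) (p : S)
    (V W : TangentSpace (𝓡 3) (F t₀ p)) :
    (ofRiemannian h).val (F t₀ p)
        ((ofRiemannian h).leviCivita.curvature (F t₀ p) (tvelocity (𝓡 3) F t₀ p) V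
          (tvelocity (𝓡 3) F t₀ p)) W =
      f p ^ 2 * (ofRiemannian h).val (F t₀ p)
        ((ofRiemannian h).leviCivita.curvature (F t₀ p) (ν p) V (ν p)) W := by
  rw [hvel p]
  simp only [map_smul, FunLike.coe_smul, Pi.smul_apply, smul_eq_mul]
  ring

end AtTime


/-! ### Frame formulas in an orthonormal basis of `T_p S` adapted to `F_{t₀}` -/

section Frame

variable {hpb : contMDiff_pullbackBilin (𝓡 3) X (𝓡 2) S ∞} {t₀ : ℝ} {ν : NormalField (𝓡 3) (F t₀)}
  {f : S → ℝ} {p : S} {β : Module.Basis (Fin 2) ℝ (TangentSpace (𝓡 2) p)}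

omit [(ofRiemannian h).HasLeviCivita] in
/-- The Gram matrix of an `(F_{t₀}^*h)`-orthonormal basis is the identity. [folklore] -/
theorem gram_eq_one_of_orthonormal (hfi : (ofRiemannian h).IsSpacelikeImmersion (𝓡 2) (F t₀))
    (hβ : ∀ i j, (ofRiemannian h).val (F t₀ p) (mfderiv (𝓡 2) (𝓡 3) (F t₀) p (β i))
      (mfderiv (𝓡 2) (𝓡 3) (F t₀) p (β j)) = if i = j then 1 else 0) :
    (Matrix.of fun i j ↦ ((ofRiemannian h).inducedMetric (F t₀) hpb hfi).val p (β i) (β j)) =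
      1 := by
  ext i j
  rw [Matrix.of_apply, Matrix.one_apply, inducedMetric_val, inducedBilin_apply, hβ]

omit [(ofRiemannian h).HasLeviCivita] in
/-- An `(F_{t₀}^*h)`-orthonormal basis is orthogonal with unit (non-null) vectors. [folklore] -/
theorem isOrthoᵢ_of_orthonormal (hfi : (ofRiemannian h).IsSpacelikeImmersion (𝓡 2) (F t₀))
    (hβ : ∀ i j, (ofRiemannian h).val (F t₀ p) (mfderiv (𝓡 2) (𝓡 3) (F t₀) p (β i))
      (mfderiv (𝓡 2) (𝓡 3) (F t₀) p (β j)) = if i = j then 1 else 0) :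
    (((ofRiemannian h).inducedMetric (F t₀) hpb hfi).toBilinForm p).IsOrthoᵢ β ∧
      ∀ i, ((ofRiemannian h).inducedMetric (F t₀) hpb hfi).val p (β i) (β i) = 1 := by
  refine ⟨fun i j hij ↦ ?_, fun i ↦ ?_⟩
  · simp only [Function.onFun, toBilinForm_apply, inducedMetric_val, inducedBilin_apply, hβ,
      if_neg hij]
  · rw [inducedMetric_val, inducedBilin_apply, hβ, if_pos rfl]

/-- **The mean curvature in an orthonormal frame**: `H = K(β₀, β₀) + K(β₁, β₁)` (`tr_g K = gⁱʲ Kᵢⱼ`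
with `gᵢⱼ = δᵢⱼ`). O'Neill 1983, Ch. 3, pp. 60–61. [cite: ONeill1983, Ch. 3, pp. 60–61] -/
theorem meanCurvature_eq_of_orthonormal (hfi : (ofRiemannian h).IsSpacelikeImmersion (𝓡 2) (F t₀))
    (hβ : ∀ i j, (ofRiemannian h).val (F t₀ p) (mfderiv (𝓡 2) (𝓡 3) (F t₀) p (β i))
      (mfderiv (𝓡 2) (𝓡 3) (F t₀) p (β j)) = if i = j then 1 else 0) (N : NormalField (𝓡 3) (F t₀)) :
    (ofRiemannian h).meanCurvature (F t₀) hpb hfi N p =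
      (ofRiemannian h).secondFundamentalForm (𝓡 2) (F t₀) N p (β 0) (β 0) +
        (ofRiemannian h).secondFundamentalForm (𝓡 2) (F t₀) N p (β 1) (β 1) := by
  rw [meanCurvature, trace_eq_sum_gram_inv _ p β, gram_eq_one_of_orthonormal hfi hβ, inv_one]
  simp [Matrix.one_apply, Fin.sum_univ_two]

omit [(ofRiemannian h).HasLeviCivita] in
/-- **`‖K‖²` in an orthonormal frame**: `‖K‖² = ∑ᵢⱼ K(βⱼ, βᵢ)²` (`normSq_eq_sum_sq`).
O'Neill 1983, Ch. 3, pp. 60–61. [cite: ONeill1983, Ch. 3, pp. 60–61] -/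
theorem normSq_eq_of_orthonormal (hfi : (ofRiemannian h).IsSpacelikeImmersion (𝓡 2) (F t₀))
    (hβ : ∀ i j, (ofRiemannian h).val (F t₀ p) (mfderiv (𝓡 2) (𝓡 3) (F t₀) p (β i))
      (mfderiv (𝓡 2) (𝓡 3) (F t₀) p (β j)) = if i = j then 1 else 0)
    (K : LinearMap.BilinForm ℝ (TangentSpace (𝓡 2) p)) :
    ((ofRiemannian h).inducedMetric (F t₀) hpb hfi).normSq p K =
      K (β 0) (β 0) ^ 2 + K (β 1) (β 0) ^ 2 + K (β 0) (β 1) ^ 2 + K (β 1) (β 1) ^ 2 := by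
  classical
  obtain ⟨ho, h1⟩ := isOrthoᵢ_of_orthonormal (hpb := hpb) hfi hβ
  rw [normSq_eq_sum_sq _ p β ho (fun i ↦ by rw [h1 i]; exact one_ne_zero) K]
  simp only [Fin.sum_univ_two, h1, mul_one, div_one]
  ring

omit [(ofRiemannian h).HasLeviCivita] in
/-- **`‖∇f‖²` in an orthonormal frame**: `g⁻¹(df, df) = (df β₀)² + (df β₁)²`
(`val_sharp_sharp_eq_sum` with Gram matrix `1`). O'Neill 1983, Ch. 3, p. 60 and Def. 3.50.
[cite: ONeill1983, Ch. 3, p. 60] -/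
theorem gradSq_eq_of_orthonormal (hfi : (ofRiemannian h).IsSpacelikeImmersion (𝓡 2) (F t₀))
    (hβ : ∀ i j, (ofRiemannian h).val (F t₀ p) (mfderiv (𝓡 2) (𝓡 3) (F t₀) p (β i))
      (mfderiv (𝓡 2) (𝓡 3) (F t₀) p (β j)) = if i = j then 1 else 0) (u : S → ℝ) :
    ((ofRiemannian h).inducedMetric (F t₀) hpb hfi).gradSq u p =
      mvfderiv (𝓡 2) u p (β 0) ^ 2 + mvfderiv (𝓡 2) u p (β 1) ^ 2 := by
  set gN := (ofRiemannian h).inducedMetric (F t₀) hpb hfi with hgN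
  rw [gradSq, innerDual_eq_val_sharp_sharp, val_sharp_sharp_eq_sum gN p β,
    gram_eq_one_of_orthonormal hfi hβ, inv_one]
  simp [Matrix.one_apply, Fin.sum_univ_two]
  ring

/-- **`h(D_v ν, D_v ν) = K(v, β₀)² + K(v, β₁)²`** in an orthonormal frame: `D_v ν` is tangential
(`val_normal_normalDerivAlong`) with `h(D_v ν, dF u) = K(v, u)`, so `D_v ν = dF(∑ₖ K(v, βₖ) βₖ)`
(`val_eq_inducedMetric_add_normal`). O'Neill 1983, Ch. 4, Lemma 4.19 ff. (shape operator).
[cite: ONeill1983, Ch. 4, Lemma 4.19] -/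
theorem val_normalDerivAlong_self_eq (hpb : contMDiff_pullbackBilin (𝓡 3) X (𝓡 2) S ∞)
    (hfi : (ofRiemannian h).IsSpacelikeImmersion (𝓡 2) (F t₀))
    (hν : ContMDiff (𝓡 2) (𝓡 3).tangent ∞
      (fun y ↦ (TotalSpace.mk' E3 (F t₀ y) (ν y) : TangentBundle (𝓡 3) X)))
    (hun : (ofRiemannian h).IsUnitNormal (𝓡 2) (F t₀) ν 1)
    (hβ : ∀ i j, (ofRiemannian h).val (F t₀ p) (mfderiv (𝓡 2) (𝓡 3) (F t₀) p (β i))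
      (mfderiv (𝓡 2) (𝓡 3) (F t₀) p (β j)) = if i = j then 1 else 0)
    (v : TangentSpace (𝓡 2) p) :
    (ofRiemannian h).val (F t₀ p) ((ofRiemannian h).normalDerivAlong (F t₀) ν p v)
        ((ofRiemannian h).normalDerivAlong (F t₀) ν p v) =
      (ofRiemannian h).secondFundamentalForm (𝓡 2) (F t₀) ν p v (β 0) ^ 2 +
        (ofRiemannian h).secondFundamentalForm (𝓡 2) (F t₀) ν p v (β 1) ^ 2 := by
  set g := ofRiemannian h with hg
  set gN := g.inducedMetric (F t₀) hpb hfi with hgN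
  set N : TangentSpace (𝓡 3) (F t₀ p) := g.normalDerivAlong (F t₀) ν p v with hN
  set K : LinearMap.BilinForm ℝ (TangentSpace (𝓡 2) p) :=
    g.secondFundamentalForm (𝓡 2) (F t₀) ν p with hK
  have hKapply : ∀ u, K v u = g.val (F t₀ p) N (mfderiv (𝓡 2) (𝓡 3) (F t₀) p u) := fun u ↦
    secondFundamentalForm_apply_holds (g := g) (I' := 𝓡 2) BoundarylessManifold.isInteriorPoint
      ((hν p).mdifferentiableAt (by simp)) v u
  have hβN : ∀ i j, gN.val p (β i) (β j) = if i = j then 1 else 0 := fun i j ↦ by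
    rw [hgN, inducedMetric_val, inducedBilin_apply]; exact hβ i j
  have h00 : gN.val p (β 0) (β 0) = 1 := by rw [hβN]; rfl
  have h11 : gN.val p (β 1) (β 1) = 1 := by rw [hβN]; rfl
  have h01 : gN.val p (β 0) (β 1) = 0 := by rw [hβN]; rfl
  have h10 : gN.val p (β 1) (β 0) = 0 := by rw [hβN]; rfl
  -- the tangential part of `N`
  set aN : TangentSpace (𝓡 2) p := K v (β 0) • β 0 + K v (β 1) • β 1 with haN
  have haNβ : ∀ k, gN.val p aN (β k) = K v (β k) := by
    intro k
    fin_cases k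
    · simp only [haN, map_add, map_smul, _root_.add_apply, _root_.smul_apply, smul_eq_mul, h10, h00,
        Fin.zero_eta, Fin.isValue, mul_zero, add_zero, mul_one]
    · simp only [haN, map_add, map_smul, _root_.add_apply, _root_.smul_apply, smul_eq_mul, h01, h11,
        Fin.mk_one, Fin.isValue, mul_zero, zero_add, mul_one]
  have hA : ∀ u : TangentSpace (𝓡 2) p, g.val (F t₀ p) N (mfderiv (𝓡 2) (𝓡 3) (F t₀) p u) =
      gN.val p aN u := by
    have hlin : ((g.val (F t₀ p) N).comp (mfderiv (𝓡 2) (𝓡 3) (F t₀) p)).toLinearMap =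
        (gN.val p aN).toLinearMap := by
      refine β.ext fun k ↦ ?_
      simp only [ContinuousLinearMap.coe_coe, ContinuousLinearMap.coe_comp, Function.comp_apply,
        haNβ k, hKapply]
    intro u
    exact congrArg (fun L : TangentSpace (𝓡 2) p →ₗ[ℝ] ℝ ↦ L u) hlin
  have hdim : Module.finrank ℝ E3 = Module.finrank ℝ (EuclideanSpace ℝ (Fin 2)) + 1 := by
    simp [E3]
  have key := val_eq_inducedMetric_add_normal g hpb hfi (y := p)
    (νy := ν p) (A := N) (B := N) (a := aN) (b := aN) (ε := 1)
    (fun u ↦ hun.isNormalTo p u) (hun.val_self p) one_ne_zero hdim hA hA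
  rw [key, g.symm (F t₀ p) N (ν p)]
  change gN.val p aN aN + g.val (F t₀ p) (ν p) (g.normalDerivAlong (F t₀) ν p v) *
    g.val (F t₀ p) (ν p) (g.normalDerivAlong (F t₀) ν p v) / 1 = _
  rw [val_normal_normalDerivAlong hν hun p v, mul_zero, zero_div, add_zero]
  simp only [haN, map_add, map_smul, _root_.add_apply, _root_.smul_apply, smul_eq_mul, h00, h01, h10,
    h11]
  ring

omit [IsManifold (𝓡 2) ∞ S] in
/-- **`Ric(ν, ν)` in the adapted orthonormal frame `(dF β₀, dF β₁, ν)` of `T_{F p} X`**: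
`Ric(ν,ν) = -(h(R(ν, dFβ₀)ν, dFβ₀) + h(R(ν, dFβ₁)ν, dFβ₁))` (O'Neill 1983, Ch. 3, Lemma 3.52,
`ricci_eq_of_isOrthoᵢ_three`, and the antisymmetry `R(X,Y) = -R(Y,X)`).
[cite: ONeill1983, Ch. 3, Lemma 3.52] -/
theorem ricci_normal_eq_of_orthonormal
    (hun : (ofRiemannian h).IsUnitNormal (𝓡 2) (F t₀) ν 1)
    (hβ : ∀ i j, (ofRiemannian h).val (F t₀ p) (mfderiv (𝓡 2) (𝓡 3) (F t₀) p (β i))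
      (mfderiv (𝓡 2) (𝓡 3) (F t₀) p (β j)) = if i = j then 1 else 0) :
    (ofRiemannian h).ricci (F t₀ p) (ν p) (ν p) =
      -((ofRiemannian h).val (F t₀ p) ((ofRiemannian h).leviCivita.curvature (F t₀ p) (ν p)
          (mfderiv (𝓡 2) (𝓡 3) (F t₀) p (β 0)) (ν p)) (mfderiv (𝓡 2) (𝓡 3) (F t₀) p (β 0)) +
        (ofRiemannian h).val (F t₀ p) ((ofRiemannian h).leviCivita.curvature (F t₀ p) (ν p)
          (mfderiv (𝓡 2) (𝓡 3) (F t₀) p (β 1)) (ν p)) (mfderiv (𝓡 2) (𝓡 3) (F t₀) p (β 1))) := by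
  set g := ofRiemannian h with hg
  have h3 : Module.finrank ℝ E3 = 3 := by simp [E3]
  have hn0 : ∀ k, g.val (F t₀ p) (mfderiv (𝓡 2) (𝓡 3) (F t₀) p (β k)) (ν p) = 0 := fun k ↦ by
    rw [g.symm]; exact hun.isNormalTo p (β k)
  have hg01 : g.val (F t₀ p) (mfderiv (𝓡 2) (𝓡 3) (F t₀) p (β 0))
      (mfderiv (𝓡 2) (𝓡 3) (F t₀) p (β 1)) = 0 := by rw [hβ]; rfl
  have hg10 : g.val (F t₀ p) (mfderiv (𝓡 2) (𝓡 3) (F t₀) p (β 1))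
      (mfderiv (𝓡 2) (𝓡 3) (F t₀) p (β 0)) = 0 := by rw [hβ]; rfl
  have hg00 : g.val (F t₀ p) (mfderiv (𝓡 2) (𝓡 3) (F t₀) p (β 0))
      (mfderiv (𝓡 2) (𝓡 3) (F t₀) p (β 0)) = 1 := by rw [hβ]; rfl
  have hg11 : g.val (F t₀ p) (mfderiv (𝓡 2) (𝓡 3) (F t₀) p (β 1))
      (mfderiv (𝓡 2) (𝓡 3) (F t₀) p (β 1)) = 1 := by rw [hβ]; rfl
  have hνε : g.val (F t₀ p) (ν p) (ν p) = 1 := hun.val_self p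
  set v : Fin 3 → TangentSpace (𝓡 3) (F t₀ p) :=
    ![mfderiv (𝓡 2) (𝓡 3) (F t₀) p (β 0), mfderiv (𝓡 2) (𝓡 3) (F t₀) p (β 1), ν p] with hv
  have hv0 : v 0 = mfderiv (𝓡 2) (𝓡 3) (F t₀) p (β 0) := rfl
  have hv1 : v 1 = mfderiv (𝓡 2) (𝓡 3) (F t₀) p (β 1) := rfl
  have hv2 : v 2 = ν p := rfl
  have hvo : (g.toBilinForm (F t₀ p)).IsOrthoᵢ v := by
    intro k l hkl
    fin_cases k <;> fin_cases l <;> first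
      | exact absurd rfl hkl
      | simp only [Function.onFun, hv0, hv1, hv2, Fin.zero_eta, Fin.mk_one, Fin.reduceFinMk,
          toBilinForm_apply, hg01, hg10, hn0,
          g.symm (F t₀ p) (ν p) (mfderiv (𝓡 2) (𝓡 3) (F t₀) p (β _))]
  have hvd : ∀ k, g.toBilinForm (F t₀ p) (v k) (v k) ≠ 0 := by
    intro k
    fin_cases k
    · simp only [hv0, Fin.zero_eta, Fin.isValue, toBilinForm_apply, hg00]; exact one_ne_zero
    · simp only [hv1, Fin.mk_one, Fin.isValue, toBilinForm_apply, hg11]; exact one_ne_zero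
    · simp only [hv2, Fin.reduceFinMk, toBilinForm_apply, hνε]; exact one_ne_zero
  have hli : LinearIndependent ℝ v := LinearMap.linearIndependent_of_isOrthoᵢ hvo hvd
  haveI : FiniteDimensional ℝ (TangentSpace (𝓡 3) (F t₀ p)) :=
    inferInstanceAs (FiniteDimensional ℝ E3)
  have hcard : Fintype.card (Fin 3) = Module.finrank ℝ (TangentSpace (𝓡 3) (F t₀ p)) := by
    show Fintype.card (Fin 3) = Module.finrank ℝ E3
    rw [h3, Fintype.card_fin]
  set γ := basisOfLinearIndependentOfCardEqFinrank hli hcard with hγdef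
  have hγ : ∀ k, γ k = v k := fun k ↦
    congrFun (coe_basisOfLinearIndependentOfCardEqFinrank hli hcard) k
  have hγo : (g.toBilinForm (F t₀ p)).IsOrthoᵢ γ := by
    intro k l hkl
    simp only [Function.onFun, hγ]
    exact hvo hkl
  have hRic := ricci_eq_of_isOrthoᵢ_three g (F t₀ p) γ hγo
    (by rw [hγ]; exact hvd 0) (by rw [hγ]; exact hvd 1) (by rw [hγ]; exact hvd 2)
  simp only [hγ, hv0, hv1, hv2] at hRic
  rw [hg00, hg11] at hRic
  have hRsw : ∀ k, g.val (F t₀ p) (g.leviCivita.curvature (F t₀ p) (ν p)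
      (mfderiv (𝓡 2) (𝓡 3) (F t₀) p (β k)) (ν p)) (mfderiv (𝓡 2) (𝓡 3) (F t₀) p (β k)) =
      -g.val (F t₀ p) (g.riemann (F t₀ p) (mfderiv (𝓡 2) (𝓡 3) (F t₀) p (β k)) (ν p)
        (ν p)) (mfderiv (𝓡 2) (𝓡 3) (F t₀) p (β k)) := fun k ↦
    val_curvature_antisymm (g := g) (cov := g.leviCivita) (F t₀ p) _ _ _ _
  rw [hRic, hRsw 0, hRsw 1]
  ring

end Frame


/-! ### The Gram determinant of `dF_τ(βᵢ)` and its first two time derivatives -/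

section Det

variable {hpb : contMDiff_pullbackBilin (𝓡 3) X (𝓡 2) S ∞} {t₀ : ℝ} {ν : NormalField (𝓡 3) (F t₀)}
  {f : S → ℝ}

/-- **Second derivative of the induced metric.** For `t ∈ (a, b)`, `p ∈ S`, `v, w ∈ T_p S`, the
derivative `G'_{vw}(τ) = h(P_v, dF_τ w) + h(dF_τ v, P_w)` of `τ ↦ (F_τ^*h)(v, w)`
(`hasDerivAt_val_mfderiv`) is itself differentiable at `t`, with derivative
`h(D_t P_v, dF w) + h(P_v, P_w) + h(D_t P_w, dF v) + h(P_w, P_v)` (metric compatibility,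
`hasDerivAt_val_P_mfderiv`, and the symmetry of `h`). O'Neill 1983, Ch. 3, Prop. 3.18 (3).
[cite: ONeill1983, Ch. 3, Prop. 18 (3)] -/
theorem hasDerivAt_gramDeriv_entry
    (hF : ContMDiffOn (𝓘(ℝ, ℝ).prod (𝓡 2)) (𝓡 3) ∞ (fun q : ℝ × S ↦ F q.1 q.2) (Ioo a b ×ˢ univ))
    {t : ℝ} (ht : t ∈ Ioo a b) (p : S) (v w : TangentSpace (𝓡 2) p) :
    HasDerivAt (fun τ ↦
        (ofRiemannian h).val (F τ p)
          (covariantDerivAlong (ofRiemannian h).leviCivita (fun s ↦ F τ (curveThrough (𝓡 2) p v s))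
            (fun s ↦ tvelocity (𝓡 3) F τ (curveThrough (𝓡 2) p v s)) 0)
          (mfderiv (𝓡 2) (𝓡 3) (F τ) p w) +
        (ofRiemannian h).val (F τ p) (mfderiv (𝓡 2) (𝓡 3) (F τ) p v)
          (covariantDerivAlong (ofRiemannian h).leviCivita (fun s ↦ F τ (curveThrough (𝓡 2) p w s))
            (fun s ↦ tvelocity (𝓡 3) F τ (curveThrough (𝓡 2) p w s)) 0))
      (((ofRiemannian h).val (F t p)
          (covariantDerivAlong (ofRiemannian h).leviCivita (fun τ ↦ F τ p)
            (fun τ ↦ (covariantDerivAlong (ofRiemannian h).leviCivita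
              (fun s ↦ F τ (curveThrough (𝓡 2) p v s))
              (fun s ↦ tvelocity (𝓡 3) F τ (curveThrough (𝓡 2) p v s)) 0 :
                TangentSpace (𝓡 3) (F τ p))) t)
          (mfderiv (𝓡 2) (𝓡 3) (F t) p w) +
        (ofRiemannian h).val (F t p)
          (covariantDerivAlong (ofRiemannian h).leviCivita (fun s ↦ F t (curveThrough (𝓡 2) p v s))
            (fun s ↦ tvelocity (𝓡 3) F t (curveThrough (𝓡 2) p v s)) 0)
          (covariantDerivAlong (ofRiemannian h).leviCivita (fun s ↦ F t (curveThrough (𝓡 2) p w s))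
            (fun s ↦ tvelocity (𝓡 3) F t (curveThrough (𝓡 2) p w s)) 0)) +
      ((ofRiemannian h).val (F t p)
          (covariantDerivAlong (ofRiemannian h).leviCivita (fun τ ↦ F τ p)
            (fun τ ↦ (covariantDerivAlong (ofRiemannian h).leviCivita
              (fun s ↦ F τ (curveThrough (𝓡 2) p w s))
              (fun s ↦ tvelocity (𝓡 3) F τ (curveThrough (𝓡 2) p w s)) 0 :
                TangentSpace (𝓡 3) (F τ p))) t)
          (mfderiv (𝓡 2) (𝓡 3) (F t) p v) +
        (ofRiemannian h).val (F t p)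
          (covariantDerivAlong (ofRiemannian h).leviCivita (fun s ↦ F t (curveThrough (𝓡 2) p w s))
            (fun s ↦ tvelocity (𝓡 3) F t (curveThrough (𝓡 2) p w s)) 0)
          (covariantDerivAlong (ofRiemannian h).leviCivita (fun s ↦ F t (curveThrough (𝓡 2) p v s))
            (fun s ↦ tvelocity (𝓡 3) F t (curveThrough (𝓡 2) p v s)) 0))) t := by
  have h1 := hasDerivAt_val_P_mfderiv (h := h) hF ht p v w
  have h2 := hasDerivAt_val_P_mfderiv (h := h) hF ht p w v
  have hsymm : (fun τ ↦ (ofRiemannian h).val (F τ p) (mfderiv (𝓡 2) (𝓡 3) (F τ) p v)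
      (covariantDerivAlong (ofRiemannian h).leviCivita (fun s ↦ F τ (curveThrough (𝓡 2) p w s))
        (fun s ↦ tvelocity (𝓡 3) F τ (curveThrough (𝓡 2) p w s)) 0)) =
      fun τ ↦ (ofRiemannian h).val (F τ p)
        (covariantDerivAlong (ofRiemannian h).leviCivita (fun s ↦ F τ (curveThrough (𝓡 2) p w s))
          (fun s ↦ tvelocity (𝓡 3) F τ (curveThrough (𝓡 2) p w s)) 0)
        (mfderiv (𝓡 2) (𝓡 3) (F τ) p v) := by
    funext τ
    exact (ofRiemannian h).symm (F τ p) _ _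
  have h3 := h1.add h2
  rw [← hsymm] at h3
  exact h3

set_option maxHeartbeats 1600000 in
/-- **The second variation of the area element (pointwise), for a normal variation field.** Let
`F : ℝ → S → X` be a smooth family of immersions of a surface into a Riemannian `3`-manifold on
`(a, b) × S`, `t₀ ∈ (a, b)`, `ν` a smooth unit normal field along `F_{t₀}`, and suppose the
variation field at `t₀` is normal, `∂ₜF(t₀, ·) = f ν` with `f ∈ C¹(S)`. For `p ∈ S` and an
`(F_{t₀}^*h)`-orthonormal basis `β` of `T_p S`, the Gram determinant
`D(τ) = det (h(dF_τ βᵢ, dF_τ βⱼ))` (the square of the area element of `F_τ^*h` relative to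
`F_{t₀}^*h` at `p`) is differentiable at every `τ ∈ (a, b)` with derivative `D₁(τ)`, and
`D(t₀) = 1`, `D₁(t₀) = 2 f H`,
`D₁'(t₀) = 2‖∇f‖² − 2f²‖A‖² + 4f²H² − 2f² Ric(ν,ν) + 2 ∑ᵢ h(D_{βᵢ} a, dF βᵢ)`,
where `H`, `‖A‖²`, `‖∇f‖²` are the mean curvature, the square norm of the second fundamental form
and the squared gradient of `f` for `F_{t₀}^*h` at `p`, and `a = D_t ∂ₜF` is the acceleration field
of the family at `t₀`. Consequently the area element `J = √D` has `J'(t₀) = f H` and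
`J''(t₀) = ‖∇f‖² − f²‖A‖² + f²H² − f² Ric(ν,ν) + ∑ᵢ h(D_{βᵢ} a, dF βᵢ)` — Lawson's second
variation formula (1980, Ch. I, Thm. 7.2) before integration, for a general (not necessarily
normal-speed) family; Huisken–Polden 1999, Thm. 3.2; Schoen–Yau 1979 use its integrated form at a
minimal immersion, (2.13). Proof: `G' = 2fK` at `t₀` (`val_P_mfderiv_eq`), `G''` from
`hasDerivAt_gramDeriv_entry` with `D_t P_v = D_v a + f² R(ν, dF v)ν` (`val_covariantDerivAlong_P_eq`)
and `h(P_v, P_w) = (vf)(wf) + f² h(D_vν, D_wν)` (`val_P_P_eq`), the `2 × 2` determinant, and the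
frame formulas for `H`, `‖A‖²`, `‖∇f‖²`, `Ric(ν,ν)`.
[cite: SchoenYauPMT1979, §2 (2.13), p. 53] -/
theorem hasDerivAt_det_gram
    (hF : ContMDiffOn (𝓘(ℝ, ℝ).prod (𝓡 2)) (𝓡 3) ∞ (fun q : ℝ × S ↦ F q.1 q.2) (Ioo a b ×ˢ univ))
    (hfi : (ofRiemannian h).IsSpacelikeImmersion (𝓡 2) (F t₀)) (ht₀ : t₀ ∈ Ioo a b)
    (hν : ContMDiff (𝓡 2) (𝓡 3).tangent ∞
      (fun y ↦ (TotalSpace.mk' E3 (F t₀ y) (ν y) : TangentBundle (𝓡 3) X)))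
    (hun : (ofRiemannian h).IsUnitNormal (𝓡 2) (F t₀) ν 1)
    (hf : ContMDiff (𝓡 2) 𝓘(ℝ, ℝ) 1 f) (hvel : ∀ y, tvelocity (𝓡 3) F t₀ y = f y • ν y)
    (p : S) (β : Module.Basis (Fin 2) ℝ (TangentSpace (𝓡 2) p))
    (hβ : ∀ i j, (ofRiemannian h).val (F t₀ p) (mfderiv (𝓡 2) (𝓡 3) (F t₀) p (β i))
      (mfderiv (𝓡 2) (𝓡 3) (F t₀) p (β j)) = if i = j then 1 else 0) :
    ∃ D₁ : ℝ → ℝ,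
      (∀ τ ∈ Ioo a b, HasDerivAt (fun τ ↦ (Matrix.of fun i j ↦ (ofRiemannian h).val (F τ p)
        (mfderiv (𝓡 2) (𝓡 3) (F τ) p (β i)) (mfderiv (𝓡 2) (𝓡 3) (F τ) p (β j))).det) (D₁ τ) τ) ∧
      (Matrix.of fun i j ↦ (ofRiemannian h).val (F t₀ p)
        (mfderiv (𝓡 2) (𝓡 3) (F t₀) p (β i)) (mfderiv (𝓡 2) (𝓡 3) (F t₀) p (β j))).det = 1 ∧
      D₁ t₀ = 2 * f p * (ofRiemannian h).meanCurvature (F t₀) hpb hfi ν p ∧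
      HasDerivAt D₁
        (2 * ((ofRiemannian h).inducedMetric (F t₀) hpb hfi).gradSq f p
          - 2 * f p ^ 2 * ((ofRiemannian h).inducedMetric (F t₀) hpb hfi).normSq p
              ((ofRiemannian h).secondFundamentalForm (𝓡 2) (F t₀) ν p)
          + 4 * f p ^ 2 * (ofRiemannian h).meanCurvature (F t₀) hpb hfi ν p ^ 2
          - 2 * f p ^ 2 * (ofRiemannian h).ricci (F t₀ p) (ν p) (ν p)
          + 2 * ∑ i, (ofRiemannian h).val (F t₀ p)
              ((ofRiemannian h).normalDerivAlong (F t₀)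
                (acceleration (𝓡 3) (ofRiemannian h).leviCivita F t₀) p (β i))
              (mfderiv (𝓡 2) (𝓡 3) (F t₀) p (β i))) t₀ := by
  -- the fields `P_i(τ)`, `D_t P_i` and the matrices `G`, `G'`
  set Pf : Fin 2 → ℝ → E3 := fun i τ ↦ covariantDerivAlong (ofRiemannian h).leviCivita
    (fun s ↦ F τ (curveThrough (𝓡 2) p (β i) s))
    (fun s ↦ tvelocity (𝓡 3) F τ (curveThrough (𝓡 2) p (β i) s)) 0 with hPf
  set DP : Fin 2 → ℝ → E3 := fun i t ↦ covariantDerivAlong (ofRiemannian h).leviCivita (fun τ ↦ F τ p)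
    (fun τ ↦ (Pf i τ : TangentSpace (𝓡 3) (F τ p))) t with hDP
  set G : ℝ → Fin 2 → Fin 2 → ℝ := fun τ i j ↦ (ofRiemannian h).val (F τ p) (mfderiv (𝓡 2) (𝓡 3) (F τ) p (β i))
    (mfderiv (𝓡 2) (𝓡 3) (F τ) p (β j)) with hGdef
  set G₁ : ℝ → Fin 2 → Fin 2 → ℝ := fun τ i j ↦
    (ofRiemannian h).val (F τ p) (Pf i τ) (mfderiv (𝓡 2) (𝓡 3) (F τ) p (β j)) +
      (ofRiemannian h).val (F τ p) (mfderiv (𝓡 2) (𝓡 3) (F τ) p (β i)) (Pf j τ) with hG₁def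
  set G₂ : Fin 2 → Fin 2 → ℝ := fun i j ↦
    ((ofRiemannian h).val (F t₀ p) (DP i t₀) (mfderiv (𝓡 2) (𝓡 3) (F t₀) p (β j)) +
      (ofRiemannian h).val (F t₀ p) (Pf i t₀) (Pf j t₀)) +
    ((ofRiemannian h).val (F t₀ p) (DP j t₀) (mfderiv (𝓡 2) (𝓡 3) (F t₀) p (β i)) +
      (ofRiemannian h).val (F t₀ p) (Pf j t₀) (Pf i t₀)) with hG₂def
  set D₁ : ℝ → ℝ := fun τ ↦ G₁ τ 0 0 * G τ 1 1 + G τ 0 0 * G₁ τ 1 1 -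
    (G₁ τ 0 1 * G τ 1 0 + G τ 0 1 * G₁ τ 1 0) with hD₁def
  -- derivatives of the entries
  have hGd : ∀ τ ∈ Ioo a b, ∀ i j, HasDerivAt (fun τ ↦ G τ i j) (G₁ τ i j) τ :=
    fun τ hτ i j ↦ hasDerivAt_val_mfderiv hF hτ p (β i) (β j)
  have hG₁d : ∀ i j, HasDerivAt (fun τ ↦ G₁ τ i j) (G₂ i j) t₀ :=
    fun i j ↦ hasDerivAt_gramDeriv_entry hF ht₀ p (β i) (β j)
  refine ⟨D₁, fun τ hτ ↦ ?_, ?_, ?_, ?_⟩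
  · -- (1) `D' = D₁` on `(a, b)`
    have h := hasDerivAt_det_fin_two (G := fun τ ↦ Matrix.of (G τ)) (G' := Matrix.of (G₁ τ))
      (t := τ) (fun i j ↦ by simpa only [Matrix.of_apply] using hGd τ hτ i j)
    simpa only [Matrix.of_apply] using h
  · -- (2) `D(t₀) = 1`
    rw [Matrix.det_fin_two]
    simp only [Matrix.of_apply]
    rw [hβ 0 0, hβ 1 1, hβ 0 1, hβ 1 0]
    norm_num
  · -- (3) `D₁(t₀) = 2 f H`
    have hK : ∀ i j, (ofRiemannian h).val (F t₀ p) (Pf i t₀) (mfderiv (𝓡 2) (𝓡 3) (F t₀) p (β j)) =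
        f p * (ofRiemannian h).secondFundamentalForm (𝓡 2) (F t₀) ν p (β i) (β j) :=
      fun i j ↦ val_P_mfderiv_eq hν hun hf hvel p (β i) (β j)
    have hK' : ∀ i j, (ofRiemannian h).val (F t₀ p) (mfderiv (𝓡 2) (𝓡 3) (F t₀) p (β i)) (Pf j t₀) =
        f p * (ofRiemannian h).secondFundamentalForm (𝓡 2) (F t₀) ν p (β j) (β i) := fun i j ↦ by
      rw [(ofRiemannian h).symm (F t₀ p)]; exact hK j i
    have hG00 : G t₀ 0 0 = 1 := by
      simp only [hGdef]; rw [hβ]; simp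
    have hG11 : G t₀ 1 1 = 1 := by
      simp only [hGdef]; rw [hβ]; simp
    have hG01 : G t₀ 0 1 = 0 := by
      simp only [hGdef]; rw [hβ]; simp
    have hG10 : G t₀ 1 0 = 0 := by
      simp only [hGdef]; rw [hβ]; simp
    simp only [hD₁def, hG₁def, hK, hK', hG00, hG11, hG01, hG10,
      meanCurvature_eq_of_orthonormal (hpb := hpb) hfi hβ ν]
    ring
  · -- (4) `D₁' (t₀)`
    have hD : HasDerivAt D₁ (G₂ 0 0 * G t₀ 1 1 + G₁ t₀ 0 0 * G₁ t₀ 1 1 +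
        (G₁ t₀ 0 0 * G₁ t₀ 1 1 + G t₀ 0 0 * G₂ 1 1) -
        (G₂ 0 1 * G t₀ 1 0 + G₁ t₀ 0 1 * G₁ t₀ 1 0 +
          (G₁ t₀ 0 1 * G₁ t₀ 1 0 + G t₀ 0 1 * G₂ 1 0))) t₀ :=
      (((hG₁d 0 0).mul (hGd t₀ ht₀ 1 1)).add ((hGd t₀ ht₀ 0 0).mul (hG₁d 1 1))).sub
        (((hG₁d 0 1).mul (hGd t₀ ht₀ 1 0)).add ((hGd t₀ ht₀ 0 1).mul (hG₁d 1 0)))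
    refine hD.congr_deriv ?_
    -- the values at `t₀`
    have hG00 : G t₀ 0 0 = 1 := by
      simp only [hGdef]; rw [hβ]; simp
    have hG11 : G t₀ 1 1 = 1 := by
      simp only [hGdef]; rw [hβ]; simp
    have hG01 : G t₀ 0 1 = 0 := by
      simp only [hGdef]; rw [hβ]; simp
    have hG10 : G t₀ 1 0 = 0 := by
      simp only [hGdef]; rw [hβ]; simp
    have hK : ∀ i j, (ofRiemannian h).val (F t₀ p) (Pf i t₀) (mfderiv (𝓡 2) (𝓡 3) (F t₀) p (β j)) =
        f p * (ofRiemannian h).secondFundamentalForm (𝓡 2) (F t₀) ν p (β i) (β j) :=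
      fun i j ↦ val_P_mfderiv_eq hν hun hf hvel p (β i) (β j)
    have hK' : ∀ i j, (ofRiemannian h).val (F t₀ p) (mfderiv (𝓡 2) (𝓡 3) (F t₀) p (β i)) (Pf j t₀) =
        f p * (ofRiemannian h).secondFundamentalForm (𝓡 2) (F t₀) ν p (β j) (β i) := fun i j ↦ by
      rw [(ofRiemannian h).symm (F t₀ p)]; exact hK j i
    have hKs : (ofRiemannian h).secondFundamentalForm (𝓡 2) (F t₀) ν p (β 1) (β 0) =
        (ofRiemannian h).secondFundamentalForm (𝓡 2) (F t₀) ν p (β 0) (β 1) := by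
      have hF2 : ContMDiff (𝓡 2) (𝓡 3) 2 (F t₀) :=
        hfi.contMDiff_self.of_le (by exact WithTop.coe_le_coe.2 le_top)
      have hs := secondFundamentalForm_symm_holds (g := ofRiemannian h) (I' := 𝓡 2) hF2 hun.isNormalTo
        (hν.of_le (by exact WithTop.coe_le_coe.2 le_top)) (y := p)
        BoundarylessManifold.isInteriorPoint
      exact LinearMap.BilinForm.isSymm_def.1 hs (β 1) (β 0)
    have hPP : ∀ i j, (ofRiemannian h).val (F t₀ p) (Pf i t₀) (Pf j t₀) =
        mvfderiv (𝓡 2) f p (β i) * mvfderiv (𝓡 2) f p (β j) +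
          f p ^ 2 * (ofRiemannian h).val (F t₀ p) ((ofRiemannian h).normalDerivAlong (F t₀) ν p (β i))
            ((ofRiemannian h).normalDerivAlong (F t₀) ν p (β j)) :=
      fun i j ↦ val_P_P_eq hν hun hf hvel p (β i) (β j)
    have hNN : ∀ i, (ofRiemannian h).val (F t₀ p) ((ofRiemannian h).normalDerivAlong (F t₀) ν p (β i))
        ((ofRiemannian h).normalDerivAlong (F t₀) ν p (β i)) =
        (ofRiemannian h).secondFundamentalForm (𝓡 2) (F t₀) ν p (β i) (β 0) ^ 2 +
          (ofRiemannian h).secondFundamentalForm (𝓡 2) (F t₀) ν p (β i) (β 1) ^ 2 :=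
      fun i ↦ val_normalDerivAlong_self_eq hpb hfi hν hun hβ (β i)
    have hDPv : ∀ i j, (ofRiemannian h).val (F t₀ p) (DP i t₀) (mfderiv (𝓡 2) (𝓡 3) (F t₀) p (β j)) =
        (ofRiemannian h).val (F t₀ p) ((ofRiemannian h).normalDerivAlong (F t₀) (acceleration (𝓡 3) (ofRiemannian h).leviCivita F t₀) p (β i))
          (mfderiv (𝓡 2) (𝓡 3) (F t₀) p (β j)) +
        f p ^ 2 * (ofRiemannian h).val (F t₀ p) ((ofRiemannian h).leviCivita.curvature (F t₀ p) (ν p)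
          (mfderiv (𝓡 2) (𝓡 3) (F t₀) p (β i)) (ν p)) (mfderiv (𝓡 2) (𝓡 3) (F t₀) p (β j)) := by
      intro i j
      have h1 := val_covariantDerivAlong_P_eq (h := h) hF ht₀ p (β i) (mfderiv (𝓡 2) (𝓡 3) (F t₀) p (β j))
      rw [val_curvature_tvelocity_eq hvel p] at h1
      exact h1
    have hRic := ricci_normal_eq_of_orthonormal (h := h) hun hβ
    have hH := meanCurvature_eq_of_orthonormal (hpb := hpb) hfi hβ ν
    have hA := normSq_eq_of_orthonormal (hpb := hpb) hfi hβ ((ofRiemannian h).secondFundamentalForm (𝓡 2) (F t₀) ν p)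
    have hgrad := gradSq_eq_of_orthonormal (hpb := hpb) hfi hβ f
    simp only [hG₂def, hG₁def, hDPv, hPP, hNN, hK, hK', hG00, hG11, hG01, hG10, hKs, hH, hA,
      hgrad, hRic, Fin.sum_univ_two, Fin.isValue]
    ring

end Det

end SurfaceVariation

end Literature.Geometry.Lorentzian

end
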